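import Literature.Barriers.ABC.BakerMethodBoundsKummerPlaceBoundsRegimeTwoProofs
import HarnessLib

/-!
# Proofs for `BakerMethodBounds`, VII-C: the deduction from the two LINEAR `p`-adic place bounds

`Literature/Barriers/ABC/BakerMethodBoundsLinearPlaceBoundsProofs.lean` — sequel to
`BakerMethodBoundsKummerPlaceBoundsProofs.lean` (VII-A) and `BakerMethodBoundsKummerPlaceBoundsRegimeTwoProofs.lean`
(VII-B) (theorems only; no definition, no named fact).  Files VII-A/B derive the barrier declaration
`BakerMethodBounds = BakerShapeBound (1/3) 3` (Stewart–Yu 2001, Theorem 1 [cite: StewartYu2001, Theorem 1]) from the two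
`p`-adic PLACE BOUNDS at threshold `N = 0` (`Θ_{uv} = theta K u v 0 = K^{ω(uv)+1} ∏_{q ∣ uv} log q`, `Y = log max{e, 2 log c}`)

* (p ∣ a) `ν_p(a) log p < Θ_{bc} · (p / log p)(log p + Y)`,
* (p ∣ c) `ν_p(c) log p < Θ_{ab} · (p / log p)(log p + Y)` for `ab > 1`,

and a Kummer-conditional archimedean bound `hW₂` of the shape of Waldschmidt 1980, Prop. 3.8.  This file re-runs that
deduction with the WEAKER, LINEAR place factor `p · (log p + Y)` in place of `(p / log p) · (log p + Y)`:

* (p ∣ a) `ν_p(a) log p < Θ_{bc} · p (log p + Y)`,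
* (p ∣ c) `ν_p(c) log p < Θ_{ab} · p (log p + Y)` for `ab > 1`,

ending in `BakerMethodBounds_of_placeBoundsLin_kummerArchBound₂ : 1 ≤ K → (linear p∣a bound) → (linear p∣c bound) →
(Kummer arch bound, any constants `Cw n ≥ 0`) → BakerMethodBounds` — the exponent `1/3` AND the power `(log R)^3`
survive the loss of the factor `1/log p`.  Mechanism (the only change w.r.t. VII-A/B): at a prime `q ∣ abc` one has
`log q ≤ Λ := max(1, log R)`, `R = rad(abc)`, so `q (log q + Y) ≤ 3 q (Λ + Y)` replaces `(q/log q)(log q + Y) ≤ 3 q Y`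
(`div_log_mul_add_le`), and every lemma of VII-A/B keeps its shape with `Y` replaced by `Y′ := Λ + Y`:
regime I (`c ≤ a²`, the cube of the three `p`-adic routes, `cube_combine` verbatim) gives
`(log c)³ ≤ 64 K⁹ (2C)³ Λ⁶ Y′³ R`, and `le_of_cube_le_lin` splits `Y ≤ Λ` (then `Y′³ ≤ 8Λ³`, `log c ≤ 8 K³ C Λ³ R^{1/3}`
directly) / `Λ < Y` (then `Y′³ ≤ 8 Y³` and `le_of_cube_le` with `2C`); regime II (`a² < c`, the `2`-Kummer descent of
VII-B verbatim in the generic `Y′`) gives `log c ≤ M₀ R^{7/24} Λ⁶ Y′²`, and `regimeII_endgame6_lin` splits `Y ≤ Λ`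
(`Λ⁸ R^{7/24} ≤ 8·240⁵ R^{1/3} (log R)³` by the `R^{1/24}` slack) / `Λ < Y` (`regimeII_endgame6` with `4M₀`).  So the
shape stays `(1/3, 3)` with larger constants.  Purpose (cell abc-stewartyu, rung route `PadicPrimesKummerThird`,
planner's fallback spec `LinDoorSpec`): the door through which `p`-adic bounds for rational primes with the LINEAR
dependence `p` (what the cell's landed `v1` slab record yields at every odd `p`) — instead of `p / log p` — still give
Stewart–Yu 2001's exponent `1/3` once `hW₂` is discharged by `Literature.NumberTheory.Transcendental.Waldschmidt1980.
waldschmidt1980_hW₂`.  Everything here is the tree's own deduction re-keyed; no new mathematics, and no claim about which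
printed `p`-adic estimate realises either place factor (that is the cell's business: files VII-A/B take the `p / log p`
factor of Yu-2007 quality, this file the linear factor of the cell's slab record).

## References

* [StewartYu2001] C. L. Stewart, K. Yu, *On the abc conjecture, II*, Duke Math. J. 108 (2001), 169–181 — Theorem 1
  and §3 (the three routes, as reconstructed in `BakerMethodBoundsThreeRoutesProofs.lean`).
* [Waldschmidt1980] M. Waldschmidt, *A lower bound for linear forms in logarithms*, Acta Arith. 37 (1980), 257–283 —
  Prop. 3.8 (the archimedean input of regime II).
* [Pasten2024] H. Pasten, *The largest prime factor of `n² + 1` and improvements on subexponential ABC*, Invent. Math.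
  236 (2024) — §§4–5 (the place bounds at threshold `N`).
-/

noncomputable section

open Finset Real Height Polynomial IntermediateField
open Literature.NumberTheory.DiophantineGeometry
open Literature.NumberTheory.DiophantineGeometry.Dioph
open Literature.NumberTheory.DiophantineGeometry.Pasten

namespace Literature.Barriers.ABC

section LinearPlaceBoundsRoutes

variable {K : ℝ} {a b c : ℕ}

/-- Numerics at a prime `q` with `log q ≤ Λ`: `q (log q + Y) ≤ 3 q (Λ + Y)` (`Y ≥ 1`). [folklore] -/
private theorem mul_log_add_le_three_mul {q : ℕ} (hq : q.Prime) {Λ Y : ℝ} (hqΛ : Real.log q ≤ Λ)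
    (hY : 1 ≤ Y) : (q : ℝ) * (Real.log q + Y) ≤ 3 * q * (Λ + Y) := by
  have hq0 : (0 : ℝ) ≤ q := Nat.cast_nonneg q
  have hlog0 : 0 ≤ Real.log q := Real.log_nonneg (by exact_mod_cast hq.one_lt.le)
  have h1 : (q : ℝ) * (Real.log q + Y) ≤ q * (Λ + Y) :=
    mul_le_mul_of_nonneg_left (by linarith) hq0
  have h2 : (q : ℝ) * (Λ + Y) ≤ 3 * q * (Λ + Y) := by nlinarith
  exact h1.trans h2

/-- **Route through `a`, linear `p`-adic place bound:** if `log p ≤ Λ` for the primes of `a`, then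
`log a ≤ Θ_{bc} · (Λ + Y) · 3 ∑_{p ∣ a} p` with `Θ_{bc} = theta K b c 0`, `Y = log max{e, 2 log c}`.
[cite: StewartYu2001, §3, as reconstructed] -/
theorem log_le_route_a₂_placeBoundsLin (hK : 1 ≤ K)
    (hpad : ∀ {a b c : ℕ}, IsABCTriple a b c → ∀ {p : ℕ}, p.Prime → p ∣ a →
      (a.factorization p : ℝ) * Real.log p < theta K b c 0 *
        ((p : ℝ) * (Real.log p + Real.log (max (Real.exp 1) (2 * Real.log c)))))
    (h : IsABCTriple a b c) {Λ : ℝ} (hΛa : ∀ p ∈ a.primeFactors, Real.log p ≤ Λ) :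
    Real.log a ≤ theta K b c 0 * (Λ + Real.log (max (Real.exp 1) (2 * Real.log c))) *
      (3 * ∑ p ∈ a.primeFactors, (p : ℝ)) := by
  obtain ⟨ha, hb, habc, hcop⟩ := id h
  set Θ := theta K b c 0 with hΘ
  set Y := Real.log (max (Real.exp 1) (2 * Real.log c)) with hY
  have hY1 : 1 ≤ Y := one_le_log_max_exp _
  have hΘ0 : 0 ≤ Θ := theta_nonneg (zero_le_one.trans hK) b c 0
  have hloga : Real.log a = ∑ p ∈ a.primeFactors, (a.factorization p : ℝ) * Real.log p :=
    log_eq_sum_factorization_mul_log ha.ne'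
  have hsum : ∑ p ∈ a.primeFactors, (a.factorization p : ℝ) * Real.log p ≤
      ∑ p ∈ a.primeFactors, Θ * (3 * p * (Λ + Y)) := by
    refine Finset.sum_le_sum fun p hp => ?_
    have hp' := Nat.prime_of_mem_primeFactors hp
    have hpa := Nat.dvd_of_mem_primeFactors hp
    have h1 := hpad h hp' hpa
    have h2 : (p : ℝ) * (Real.log p + Y) ≤ 3 * p * (Λ + Y) :=
      mul_log_add_le_three_mul hp' (hΛa p hp) hY1
    exact (h1.trans_le (mul_le_mul_of_nonneg_left h2 hΘ0)).le
  have hsum' : ∑ p ∈ a.primeFactors, Θ * (3 * p * (Λ + Y)) =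
      Θ * (Λ + Y) * (3 * ∑ p ∈ a.primeFactors, (p : ℝ)) := by
    rw [Finset.mul_sum, Finset.mul_sum]
    exact Finset.sum_congr rfl fun p _ => by ring
  rw [hloga, ← hsum']; exact hsum

/-- **Route through `c`, linear `p`-adic place bound** (needs `ab > 1`): if `log p ≤ Λ` for the primes of `c`,
`log c < Θ_{ab} · (Λ + Y) · (1 + 3 ∑_{p ∣ c} p)`. [cite: StewartYu2001, §3, as reconstructed] -/
theorem log_lt_route_c₂_placeBoundsLin (hK : 1 ≤ K)
    (hpadc : ∀ {a b c : ℕ}, IsABCTriple a b c → 1 < a * b → ∀ {p : ℕ}, p.Prime → p ∣ c →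
      (c.factorization p : ℝ) * Real.log p < theta K a b 0 *
        ((p : ℝ) * (Real.log p + Real.log (max (Real.exp 1) (2 * Real.log c)))))
    (h : IsABCTriple a b c) (h1 : 1 < a * b) {Λ : ℝ} (hΛc : ∀ p ∈ c.primeFactors, Real.log p ≤ Λ) :
    Real.log c < theta K a b 0 * (Λ + Real.log (max (Real.exp 1) (2 * Real.log c))) *
      (1 + 3 * ∑ p ∈ c.primeFactors, (p : ℝ)) := by
  obtain ⟨ha, hb, habc, hcop⟩ := id h
  set Θ := theta K a b 0 with hΘ
  set Y := Real.log (max (Real.exp 1) (2 * Real.log c)) with hY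
  have hc : c ≠ 0 := by omega
  have hY1 : 1 ≤ Y := one_le_log_max_exp _
  have hΘpos : 0 < Θ := theta_zero_pos hK ha.ne' hb.ne' hcop
  have hΘ0 : 0 ≤ Θ := hΘpos.le
  -- `0 ≤ Λ` when `c` has a prime factor; in general we only need `0 < Θ (Λ + Y)` through `c ≥ 2`
  have hc2 : 2 ≤ c := by omega
  obtain ⟨p₀, hp₀⟩ : c.primeFactors.Nonempty :=
    Nat.nonempty_primeFactors.mpr (by omega)
  have hΛ0 : 0 ≤ Λ :=
    (Real.log_nonneg (by exact_mod_cast (Nat.prime_of_mem_primeFactors hp₀).one_lt.le)).trans (hΛc p₀ hp₀)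
  have hlogc : Real.log c = ∑ p ∈ c.primeFactors, (c.factorization p : ℝ) * Real.log p :=
    log_eq_sum_factorization_mul_log hc
  have hsum : ∑ p ∈ c.primeFactors, (c.factorization p : ℝ) * Real.log p ≤
      ∑ p ∈ c.primeFactors, Θ * (3 * p * (Λ + Y)) := by
    refine Finset.sum_le_sum fun p hp => ?_
    have hp' := Nat.prime_of_mem_primeFactors hp
    have hpc := Nat.dvd_of_mem_primeFactors hp
    have h1' := hpadc h h1 hp' hpc
    have h2 : (p : ℝ) * (Real.log p + Y) ≤ 3 * p * (Λ + Y) :=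
      mul_log_add_le_three_mul hp' (hΛc p hp) hY1
    exact (h1'.trans_le (mul_le_mul_of_nonneg_left h2 hΘ0)).le
  have hsum' : ∑ p ∈ c.primeFactors, Θ * (3 * p * (Λ + Y)) =
      Θ * (Λ + Y) * (3 * ∑ p ∈ c.primeFactors, (p : ℝ)) := by
    rw [Finset.mul_sum, Finset.mul_sum]
    exact Finset.sum_congr rfl fun p _ => by ring
  have hΘY : 0 < Θ * (Λ + Y) := mul_pos hΘpos (by linarith)
  calc Real.log c = ∑ p ∈ c.primeFactors, (c.factorization p : ℝ) * Real.log p := hlogc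
    _ ≤ Θ * (Λ + Y) * (3 * ∑ p ∈ c.primeFactors, (p : ℝ)) := by rw [← hsum']; exact hsum
    _ < Θ * (Λ + Y) + Θ * (Λ + Y) * (3 * ∑ p ∈ c.primeFactors, (p : ℝ)) := by linarith
    _ = Θ * (Λ + Y) * (1 + 3 * ∑ p ∈ c.primeFactors, (p : ℝ)) := by ring

/-- **The cube of the three `p`-adic routes when `a ≤ b` and `c ≤ a²`, linear place bounds.** Then
`log c ≤ 2 log a` and `log c ≤ 2 log b`, so no archimedean clause is needed:
`(log c)³ ≤ 64 K⁹ (2C)³ Λ⁶ (Λ + Y)³ R` with `R = rad(abc)`, `Λ = max(1, log R)`, `Y = log max{e, 2 log c}`,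
`C` bounding the products `∏ 4K²(log p)²/p` over finite sets of primes (`cube_combine` in the generic `Y′ = Λ + Y`).
[cite: StewartYu2001, Theorem 1 (proof), as reconstructed in the module docstring] -/
theorem log_pow_three_le_of_le_sq_placeBoundsLin (hK : 1 ≤ K)
    (hpad : ∀ {a b c : ℕ}, IsABCTriple a b c → ∀ {p : ℕ}, p.Prime → p ∣ a →
      (a.factorization p : ℝ) * Real.log p < theta K b c 0 *
        ((p : ℝ) * (Real.log p + Real.log (max (Real.exp 1) (2 * Real.log c)))))
    (hpadc : ∀ {a b c : ℕ}, IsABCTriple a b c → 1 < a * b → ∀ {p : ℕ}, p.Prime → p ∣ c →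
      (c.factorization p : ℝ) * Real.log p < theta K a b 0 *
        ((p : ℝ) * (Real.log p + Real.log (max (Real.exp 1) (2 * Real.log c)))))
    {C : ℝ} (hC1 : 1 ≤ C)
    (hC : ∀ S : Finset ℕ, (∀ p ∈ S, p.Prime) → ∏ p ∈ S, 4 * K ^ 2 * Real.log p ^ 2 / p ≤ C)
    (h : IsABCTriple a b c) (hab : a ≤ b) (hca : (c : ℝ) ≤ (a : ℝ) ^ 2) :
    Real.log c ^ 3 ≤ 64 * K ^ 9 * (2 * C) ^ 3 * max 1 (Real.log (rad a b c : ℕ)) ^ 6 *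
      (max 1 (Real.log (rad a b c : ℕ)) + Real.log (max (Real.exp 1) (2 * Real.log c))) ^ 3 *
      (rad a b c : ℝ) := by
  obtain ⟨ha, hb, habc, hcop⟩ := id h
  have hc : c ≠ 0 := by omega
  have hbc : b.Coprime c := coprime_right_of_isABCTriple h
  have hac : a.Coprime c := coprime_left_of_isABCTriple h
  have habc0 : a * b * c ≠ 0 := by positivity
  -- `a ≥ 2`, hence `ab > 1`
  have ha_r : (0 : ℝ) < a := by exact_mod_cast ha
  have hb_r : (0 : ℝ) < b := by exact_mod_cast hb
  have hc_r : (0 : ℝ) < c := by exact_mod_cast (Nat.pos_of_ne_zero hc)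
  have hac_lt : (a : ℝ) < c := by exact_mod_cast (show a < c by omega)
  have ha2 : 2 ≤ a := by
    by_contra hlt
    have ha1 : a = 1 := by omega
    subst ha1
    norm_num at hca
    have : (2 : ℝ) ≤ c := by exact_mod_cast (show 2 ≤ c by omega)
    linarith
  have h1 : 1 < a * b := by nlinarith
  set y := Real.log c with hy
  set Λ := max 1 (Real.log (rad a b c : ℕ)) with hΛdef
  have hΛ1 : 1 ≤ Λ := le_max_left _ _
  set Y := Λ + Real.log (max (Real.exp 1) (2 * y)) with hYdef
  have hy0 : 0 ≤ y := Real.log_nonneg (by exact_mod_cast Nat.one_le_iff_ne_zero.mpr hc)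
  have hY1 : 1 ≤ Y := by
    have h' := one_le_log_max_exp (2 * y)
    rw [hYdef]; linarith
  have hY0 : 0 ≤ 2 * Y := by linarith
  have hK0 : 0 ≤ K := zero_le_one.trans hK
  -- `y ≤ 2 log a`, `y ≤ 2 log b`
  have hlogsq : ∀ x : ℝ, Real.log (x ^ 2) = 2 * Real.log x := fun x => by
    rw [Real.log_pow]; push_cast; ring
  have hya : y ≤ 2 * Real.log a := by
    rw [← hlogsq]; exact Real.log_le_log hc_r hca
  have hyb : y ≤ 2 * Real.log b := by
    have hab_r : (a : ℝ) ≤ b := by exact_mod_cast hab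
    have hcb : (c : ℝ) ≤ (b : ℝ) ^ 2 := hca.trans (pow_le_pow_left₀ ha_r.le hab_r 2)
    rw [← hlogsq]; exact Real.log_le_log hc_r hcb
  -- `log p ≤ Λ` at the primes of `abc`
  have hlogle : ∀ {n : ℕ}, n ∣ a * b * c → ∀ p ∈ n.primeFactors, Real.log p ≤ Λ := by
    intro n hn p hp
    have hp' := Nat.prime_of_mem_primeFactors hp
    have hpR : (p : ℝ) ≤ (rad a b c : ℝ) := by
      exact_mod_cast prime_le_rad hp' ((Nat.dvd_of_mem_primeFactors hp).trans hn) habc0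
    have hp0 : (0 : ℝ) < p := by exact_mod_cast hp'.pos
    exact (Real.log_le_log hp0 hpR).trans (le_max_right _ _)
  -- the three routes
  have hA0 : Real.log a ≤ theta K b c 0 * Y * (3 * ∑ p ∈ a.primeFactors, (p : ℝ)) :=
    log_le_route_a₂_placeBoundsLin hK hpad h (hlogle (Dvd.intro (b * c) (by ring)))
  have hB0 : Real.log b ≤ theta K a c 0 * Y * (3 * ∑ p ∈ b.primeFactors, (p : ℝ)) :=
    log_le_route_a₂_placeBoundsLin hK hpad h.swap (hlogle (Dvd.intro (a * c) (by ring)))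
  have hC0 : Real.log c < theta K a b 0 * Y * (1 + 3 * ∑ p ∈ c.primeFactors, (p : ℝ)) :=
    log_lt_route_c₂_placeBoundsLin hK hpadc h h1 (hlogle (Dvd.intro_left (a * b) rfl))
  have hΘbc : 0 < theta K b c 0 := theta_zero_pos hK hb.ne' hc hbc
  have hΘac : 0 < theta K a c 0 := theta_zero_pos hK ha.ne' hc hac
  have hΘab : 0 < theta K a b 0 := theta_zero_pos hK ha.ne' hb.ne' hcop
  have hsum0 : ∀ n : ℕ, 0 ≤ ∑ p ∈ n.primeFactors, ((p : ℕ) : ℝ) := fun n =>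
    Finset.sum_nonneg fun p _ => Nat.cast_nonneg p
  have hA : y < theta K b c 0 * (2 * Y) * (1 + 3 * ∑ p ∈ a.primeFactors, (p : ℝ)) := by
    have := hsum0 a
    have hpos : 0 < theta K b c 0 * (2 * Y) := by positivity
    nlinarith
  have hB : y < theta K a c 0 * (2 * Y) * (1 + 3 * ∑ p ∈ b.primeFactors, (p : ℝ)) := by
    have := hsum0 b
    have hpos : 0 < theta K a c 0 * (2 * Y) := by positivity
    nlinarith
  have hCc : y < theta K a b 0 * (2 * Y) * (1 + 3 * ∑ p ∈ c.primeFactors, (p : ℝ)) := by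
    have := hsum0 c
    have hpos : 0 < theta K a b 0 * Y * (1 + 3 * ∑ p ∈ c.primeFactors, (p : ℝ)) := by positivity
    nlinarith
  rw [theta_zero_eq_split K hb.ne' hc hbc] at hA
  rw [theta_zero_eq_split K ha.ne' hc hac] at hB
  rw [theta_zero_eq_split K ha.ne' hb.ne' hcop] at hCc
  -- per-member accounting
  have hprime : ∀ n : ℕ, ∀ p ∈ n.primeFactors, p.Prime := fun n p hp =>
    Nat.prime_of_mem_primeFactors hp
  have hXa := member_accounting hK hC1 hC hΛ1 a.primeFactors (hprime a)
    (hlogle (Dvd.intro (b * c) (by ring)))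
  have hXb := member_accounting hK hC1 hC hΛ1 b.primeFactors (hprime b)
    (hlogle (Dvd.intro (a * c) (by ring)))
  have hXc := member_accounting hK hC1 hC hΛ1 c.primeFactors (hprime c)
    (hlogle (Dvd.intro_left (a * b) rfl))
  -- the radical
  have hRprod : ((rad a b c : ℕ) : ℝ) = (∏ p ∈ a.primeFactors, (p : ℝ)) *
      (∏ p ∈ b.primeFactors, (p : ℝ)) * ∏ p ∈ c.primeFactors, (p : ℝ) := by
    rw [rad_def, Nat.radical_eq_prod_primeFactors, Nat.cast_prod,
      prod_primeFactors_mul_of_coprime (mul_ne_zero ha.ne' hb.ne') hc (Nat.Coprime.mul_left hac hbc),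
      prod_primeFactors_mul_of_coprime ha.ne' hb.ne' hcop]
  have key := cube_combine hK0 hy0 hY0 (hsum0 a) (hsum0 b) (hsum0 c) hA hB hCc hXa hXb hXc
  calc Real.log c ^ 3 ≤ _ := key
    _ = 64 * K ^ 9 * (2 * C) ^ 3 * Λ ^ 6 * Y ^ 3 *
          ((∏ p ∈ a.primeFactors, (p : ℝ)) * (∏ p ∈ b.primeFactors, (p : ℝ)) *
            ∏ p ∈ c.primeFactors, (p : ℝ)) := by ring
    _ = _ := by rw [hRprod]

/-- **From the cube to the bound, linear version** (pure analysis): if `R ≥ 2`, `K, C ≥ 1` and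
`y³ ≤ 64 K⁹ C³ Λ⁶ (Λ + Y)³ R` with `Λ = max(1, log R)`, `Y = log max{e, 2y}`, then
`y ≤ 64 K³ (2C) (log(16K³(2C)) + 3) · R^{1/3} (log R)³`.  Proof: if `Y ≤ Λ` then `(Λ + Y)³ ≤ 8Λ³` and
`y ≤ 8 K³ C Λ³ R^{1/3} ≤ 64 K³ C R^{1/3} (log R)³` (`Λ ≤ 2 log R`); if `Λ < Y` then `(Λ + Y)³ ≤ 8 Y³ = (2·)³ Y³`
and `le_of_cube_le` applies with `2C`. [cite: StewartYu2001, Theorem 1 (proof, §3), as reconstructed] -/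
theorem le_of_cube_le_lin {C R y : ℝ} (hK : 1 ≤ K) (hC : 1 ≤ C) (hR : 2 ≤ R)
    (h : y ^ 3 ≤ 64 * K ^ 9 * C ^ 3 * max 1 (Real.log R) ^ 6 *
      (max 1 (Real.log R) + Real.log (max (Real.exp 1) (2 * y))) ^ 3 * R) :
    y ≤ 64 * K ^ 3 * (2 * C) * (Real.log (16 * K ^ 3 * (2 * C)) + 3) * R ^ (1 / 3 : ℝ) *
      Real.log R ^ 3 := by
  set L : ℝ := Real.log R with hL
  set Λ : ℝ := max 1 L with hΛ
  set Y : ℝ := Real.log (max (Real.exp 1) (2 * y)) with hYdef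
  have hR0 : 0 < R := by linarith
  have hK0 : 0 < K := by linarith
  have hC0 : 0 < C := by linarith
  have hY1 : 1 ≤ Y := one_le_log_max_exp _
  have hΛ1 : 1 ≤ Λ := le_max_left _ _
  have h2C : 1 ≤ 2 * C := by linarith
  have hK3 : 1 ≤ K ^ 3 := one_le_pow₀ hK
  -- `Λ ≤ 2 L`
  have hL2 : Real.log 2 ≤ L := Real.log_le_log two_pos hR
  have hlog2 : (1 / 2 : ℝ) ≤ Real.log 2 := by have := Real.log_two_gt_d9; linarith
  have hL0 : 0 ≤ L := by linarith
  have hΛL : Λ ≤ 2 * L := max_le (by linarith) (by linarith)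
  rcases le_or_gt Y Λ with hYΛ | hΛY
  · -- `Y ≤ Λ`: `(Λ + Y)³ ≤ 8 Λ³`, so `y³ ≤ (8 K³ C Λ³ R^{1/3})³`
    have hR13 : (R ^ (1 / 3 : ℝ)) ^ 3 = R := by
      rw [← Real.rpow_mul_natCast hR0.le]; norm_num
    have h3 : (Λ + Y) ^ 3 ≤ (2 * Λ) ^ 3 := pow_le_pow_left₀ (by linarith) (by linarith) 3
    have hy3 : y ^ 3 ≤ (8 * K ^ 3 * C * Λ ^ 3 * R ^ (1 / 3 : ℝ)) ^ 3 := by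
      calc y ^ 3 ≤ 64 * K ^ 9 * C ^ 3 * Λ ^ 6 * (Λ + Y) ^ 3 * R := h
        _ ≤ 64 * K ^ 9 * C ^ 3 * Λ ^ 6 * (2 * Λ) ^ 3 * R := by
            apply mul_le_mul_of_nonneg_right _ hR0.le
            exact mul_le_mul_of_nonneg_left h3 (by positivity)
        _ = (8 * K ^ 3 * C * Λ ^ 3) ^ 3 * (R ^ (1 / 3 : ℝ)) ^ 3 := by rw [hR13]; ring
        _ = (8 * K ^ 3 * C * Λ ^ 3 * R ^ (1 / 3 : ℝ)) ^ 3 := by ring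
    have hy : y ≤ 8 * K ^ 3 * C * Λ ^ 3 * R ^ (1 / 3 : ℝ) :=
      le_of_pow_le_pow_left₀ (by norm_num : (3 : ℕ) ≠ 0) (by positivity) hy3
    have hc₀0 : 0 ≤ Real.log (16 * K ^ 3 * (2 * C)) := Real.log_nonneg (by nlinarith)
    have hκ : 64 * K ^ 3 * C * 1 ≤ 64 * K ^ 3 * (2 * C) * (Real.log (16 * K ^ 3 * (2 * C)) + 3) := by
      apply mul_le_mul _ (by linarith) zero_le_one (by positivity)
      exact mul_le_mul_of_nonneg_left (by linarith) (by positivity)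
    calc y ≤ 8 * K ^ 3 * C * Λ ^ 3 * R ^ (1 / 3 : ℝ) := hy
      _ ≤ 8 * K ^ 3 * C * (2 * L) ^ 3 * R ^ (1 / 3 : ℝ) := by
          apply mul_le_mul_of_nonneg_right _ (by positivity)
          exact mul_le_mul_of_nonneg_left (pow_le_pow_left₀ (by linarith) hΛL 3) (by positivity)
      _ = 64 * K ^ 3 * C * 1 * R ^ (1 / 3 : ℝ) * L ^ 3 := by ring
      _ ≤ 64 * K ^ 3 * (2 * C) * (Real.log (16 * K ^ 3 * (2 * C)) + 3) * R ^ (1 / 3 : ℝ) *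
            L ^ 3 := by
          apply mul_le_mul_of_nonneg_right _ (by positivity)
          exact mul_le_mul_of_nonneg_right hκ (by positivity)
  · -- `Λ < Y`: `(Λ + Y)³ ≤ (2Y)³`, and `le_of_cube_le` with `2C`
    have h3 : (Λ + Y) ^ 3 ≤ (2 * Y) ^ 3 := pow_le_pow_left₀ (by linarith) (by linarith) 3
    have h' : y ^ 3 ≤ 64 * K ^ 9 * (2 * C) ^ 3 * max 1 (Real.log R) ^ 6 *
        Real.log (max (Real.exp 1) (2 * y)) ^ 3 * R := by
      calc y ^ 3 ≤ 64 * K ^ 9 * C ^ 3 * Λ ^ 6 * (Λ + Y) ^ 3 * R := h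
        _ ≤ 64 * K ^ 9 * C ^ 3 * Λ ^ 6 * (2 * Y) ^ 3 * R := by
            apply mul_le_mul_of_nonneg_right _ hR0.le
            exact mul_le_mul_of_nonneg_left h3 (by positivity)
        _ = 64 * K ^ 9 * (2 * C) ^ 3 * Λ ^ 6 * Y ^ 3 * R := by ring
    exact le_of_cube_le hK h2C hR h'

/-- **First regime, the bound, linear place bounds:** for an abc triple with `a ≤ b` and `c ≤ a²`,
`log c ≤ 64 K³ (4C) (log(64 K³ C) + 3) · R^{1/3} (log R)³` from the two linear `p`-adic place bounds alone.
[cite: StewartYu2001, Theorem 1 (proof), as reconstructed in the module docstring] -/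
theorem log_le_of_le_sq_placeBoundsLin (hK : 1 ≤ K)
    (hpad : ∀ {a b c : ℕ}, IsABCTriple a b c → ∀ {p : ℕ}, p.Prime → p ∣ a →
      (a.factorization p : ℝ) * Real.log p < theta K b c 0 *
        ((p : ℝ) * (Real.log p + Real.log (max (Real.exp 1) (2 * Real.log c)))))
    (hpadc : ∀ {a b c : ℕ}, IsABCTriple a b c → 1 < a * b → ∀ {p : ℕ}, p.Prime → p ∣ c →
      (c.factorization p : ℝ) * Real.log p < theta K a b 0 *
        ((p : ℝ) * (Real.log p + Real.log (max (Real.exp 1) (2 * Real.log c)))))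
    {C : ℝ} (hC1 : 1 ≤ C)
    (hC : ∀ S : Finset ℕ, (∀ p ∈ S, p.Prime) → ∏ p ∈ S, 4 * K ^ 2 * Real.log p ^ 2 / p ≤ C)
    (h : IsABCTriple a b c) (hab : a ≤ b) (hca : (c : ℝ) ≤ (a : ℝ) ^ 2) :
    Real.log c ≤ 64 * K ^ 3 * (2 * (2 * C)) * (Real.log (16 * K ^ 3 * (2 * (2 * C))) + 3) *
      (rad a b c : ℝ) ^ (1 / 3 : ℝ) * Real.log (rad a b c : ℕ) ^ 3 := by
  obtain ⟨ha, hb, habc, hcop⟩ := id h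
  have hR2 : (2 : ℝ) ≤ (rad a b c : ℝ) := by
    have : 2 ≤ rad a b c := by
      rw [rad_def, Nat.two_le_radical_iff]
      calc 2 ≤ c := by omega
        _ ≤ a * b * c := Nat.le_mul_of_pos_left c (by positivity)
    exact_mod_cast this
  have hcube := log_pow_three_le_of_le_sq_placeBoundsLin hK hpad hpadc hC1 hC h hab hca
  have h2C : 1 ≤ 2 * C := by linarith
  have := le_of_cube_le_lin (K := K) hK h2C hR2 hcube
  simpa using this

/-- **Height of the smooth part, linear place bounds.** For an abc triple with `ab > 1`, a set `S` of primes of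
`cb` all `≤ τ` with `log q ≤ Λ` on `S`, and `β = ∏_{q ∈ S} q^{e_q}` (`e_q = ν_q(c) − ν_q(b)`):
`h(β) ≤ #S · (Θ_{ab} + Θ_{ac}) · 3τ(Λ + Y)`, `Y = log max{e, 2 log c}`.
[cite: StewartYu2001, Theorem 1 (proof), as reconstructed] -/
theorem logHeight₁_smooth_le_placeBoundsLin (hK : 1 ≤ K)
    (hpad : ∀ {a b c : ℕ}, IsABCTriple a b c → ∀ {p : ℕ}, p.Prime → p ∣ a →
      (a.factorization p : ℝ) * Real.log p < theta K b c 0 *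
        ((p : ℝ) * (Real.log p + Real.log (max (Real.exp 1) (2 * Real.log c)))))
    (hpadc : ∀ {a b c : ℕ}, IsABCTriple a b c → 1 < a * b → ∀ {p : ℕ}, p.Prime → p ∣ c →
      (c.factorization p : ℝ) * Real.log p < theta K a b 0 *
        ((p : ℝ) * (Real.log p + Real.log (max (Real.exp 1) (2 * Real.log c)))))
    (h : IsABCTriple a b c) (h1 : 1 < a * b) (S : Finset ℕ) (hS : S ⊆ (c * b).primeFactors)
    {τ : ℝ} (hSτ : ∀ q ∈ S, (q : ℝ) ≤ τ) {Λ : ℝ} (hSΛ : ∀ q ∈ S, Real.log q ≤ Λ) :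
    logHeight₁ (∏ q ∈ S, (q : ℚ) ^ expDiff c b q) ≤
      S.card * ((theta K a b 0 + theta K a c 0) *
        (3 * τ * (Λ + Real.log (max (Real.exp 1) (2 * Real.log c))))) := by
  obtain ⟨ha, hb, habc, hcop⟩ := id h
  have hc : c ≠ 0 := by omega
  have hcb : c.Coprime b := (coprime_right_of_isABCTriple h).symm
  set Y := Real.log (max (Real.exp 1) (2 * Real.log c)) with hYdef
  have hY1 : 1 ≤ Y := one_le_log_max_exp _
  have hΘab : 0 ≤ theta K a b 0 := theta_nonneg (zero_le_one.trans hK) a b 0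
  have hΘac : 0 ≤ theta K a c 0 := theta_nonneg (zero_le_one.trans hK) a c 0
  -- per prime of `S`
  have hq : ∀ q ∈ S, ((expDiff c b q).natAbs : ℝ) * Real.log q ≤
      (theta K a b 0 + theta K a c 0) * (3 * τ * (Λ + Y)) := by
    intro q hqS
    have hqP := hS hqS
    have hqp : q.Prime := Nat.prime_of_mem_primeFactors hqP
    have hq2 : (2 : ℝ) ≤ q := by exact_mod_cast hqp.two_le
    have hlogq : 0 ≤ Real.log q := Real.log_nonneg (by linarith)
    have hΛ0 : 0 ≤ Λ := hlogq.trans (hSΛ q hqS)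
    have hnum : (q : ℝ) * (Real.log q + Y) ≤ 3 * q * (Λ + Y) :=
      mul_log_add_le_three_mul hqp (hSΛ q hqS) hY1
    have hnum0 : 0 ≤ (q : ℝ) * (Real.log q + Y) := by positivity
    have hqτ : 3 * (q : ℝ) * (Λ + Y) ≤ 3 * τ * (Λ + Y) := by
      have := hSτ q hqS; nlinarith
    -- `ν_q(c) log q ≤ Θ_{ab} (…)` and `ν_q(b) log q ≤ Θ_{ac} (…)`
    have hcq : (c.factorization q : ℝ) * Real.log q ≤
        theta K a b 0 * ((q : ℝ) * (Real.log q + Y)) := by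
      by_cases hqc : q ∣ c
      · exact (hpadc h h1 hqp hqc).le
      · rw [Nat.factorization_eq_zero_of_not_dvd hqc, Nat.cast_zero, zero_mul]
        positivity
    have hbq : (b.factorization q : ℝ) * Real.log q ≤
        theta K a c 0 * ((q : ℝ) * (Real.log q + Y)) := by
      by_cases hqb : q ∣ b
      · exact (hpad h.swap hqp hqb).le
      · rw [Nat.factorization_eq_zero_of_not_dvd hqb, Nat.cast_zero, zero_mul]
        positivity
    have hsplit : ((expDiff c b q).natAbs : ℝ) = c.factorization q + b.factorization q := by
      rw [natAbs_expDiff hc hb.ne' hcb q, Nat.factorization_mul hc hb.ne', Finsupp.add_apply]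
      push_cast; rfl
    rw [hsplit, add_mul]
    calc (c.factorization q : ℝ) * Real.log q + (b.factorization q : ℝ) * Real.log q
        ≤ (theta K a b 0 + theta K a c 0) * ((q : ℝ) * (Real.log q + Y)) := by
          linarith
      _ ≤ (theta K a b 0 + theta K a c 0) * (3 * τ * (Λ + Y)) :=
          mul_le_mul_of_nonneg_left (hnum.trans hqτ) (by positivity)
  -- sum over `S`
  calc logHeight₁ (∏ q ∈ S, (q : ℚ) ^ expDiff c b q)
      ≤ ∑ q ∈ S, logHeight₁ ((q : ℚ) ^ expDiff c b q) := logHeight₁_prod_le _ _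
    _ = ∑ q ∈ S, ((expDiff c b q).natAbs : ℝ) * Real.log q := by
        refine Finset.sum_congr rfl fun q hqS => ?_
        have hqp : q.Prime := Nat.prime_of_mem_primeFactors (hS hqS)
        haveI : NeZero q := ⟨hqp.ne_zero⟩
        rw [logHeight₁_zpow, Rat.logHeight₁_natCast]
    _ ≤ ∑ q ∈ S, (theta K a b 0 + theta K a c 0) * (3 * τ * (Λ + Y)) := Finset.sum_le_sum hq
    _ = S.card * ((theta K a b 0 + theta K a c 0) * (3 * τ * (Λ + Y))) := by
        rw [Finset.sum_const, nsmul_eq_mul]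

/-- **All primes of `c` small, linear place bounds.** If every prime of `c` is `≤ τ` with `log q ≤ Λ`, then
`log c ≤ ω(c) · Θ_{ab} · 3τ(Λ + Y)` (`ab > 1`). [cite: StewartYu2001, Theorem 1 (proof), as reconstructed] -/
theorem log_le_of_primes_le_placeBoundsLin (hK : 1 ≤ K)
    (hpadc : ∀ {a b c : ℕ}, IsABCTriple a b c → 1 < a * b → ∀ {p : ℕ}, p.Prime → p ∣ c →
      (c.factorization p : ℝ) * Real.log p < theta K a b 0 *
        ((p : ℝ) * (Real.log p + Real.log (max (Real.exp 1) (2 * Real.log c)))))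
    (h : IsABCTriple a b c) (h1 : 1 < a * b) {τ : ℝ} (hτ : ∀ q ∈ c.primeFactors, (q : ℝ) ≤ τ)
    {Λ : ℝ} (hΛ : ∀ q ∈ c.primeFactors, Real.log q ≤ Λ) :
    Real.log c ≤ c.primeFactors.card *
      (theta K a b 0 * (3 * τ * (Λ + Real.log (max (Real.exp 1) (2 * Real.log c))))) := by
  obtain ⟨ha, hb, habc, hcop⟩ := id h
  have hc : c ≠ 0 := by omega
  set Y := Real.log (max (Real.exp 1) (2 * Real.log c)) with hYdef
  have hY1 : 1 ≤ Y := one_le_log_max_exp _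
  have hΘab : 0 ≤ theta K a b 0 := theta_nonneg (zero_le_one.trans hK) a b 0
  rw [log_eq_sum_factorization_mul_log hc]
  calc ∑ q ∈ c.primeFactors, (c.factorization q : ℝ) * Real.log q
      ≤ ∑ q ∈ c.primeFactors, theta K a b 0 * (3 * τ * (Λ + Y)) := by
        refine Finset.sum_le_sum fun q hqc => ?_
        have hqp := Nat.prime_of_mem_primeFactors hqc
        have hq2 : (2 : ℝ) ≤ q := by exact_mod_cast hqp.two_le
        have hlogq : 0 ≤ Real.log q := Real.log_nonneg (by linarith)
        have hΛ0 : 0 ≤ Λ := hlogq.trans (hΛ q hqc)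
        have hb1 := hpadc h h1 hqp (Nat.dvd_of_mem_primeFactors hqc)
        have hnum : (q : ℝ) * (Real.log q + Y) ≤ 3 * q * (Λ + Y) :=
          mul_log_add_le_three_mul hqp (hΛ q hqc) hY1
        have hqτ : 3 * (q : ℝ) * (Λ + Y) ≤ 3 * τ * (Λ + Y) := by
          have := hτ q hqc; nlinarith
        exact hb1.le.trans (mul_le_mul_of_nonneg_left (hnum.trans hqτ) hΘab)
    _ = c.primeFactors.card * (theta K a b 0 * (3 * τ * (Λ + Y))) := by
        rw [Finset.sum_const, nsmul_eq_mul]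

end LinearPlaceBoundsRoutes

section RegimeTwoLinearPlaceBounds

variable {K : ℝ} {a b c : ℕ}

set_option maxHeartbeats 4000000 in
/-- **Second regime, Kummer version, from the `E = 2` form `hW₂` of the archimedean bound and the LINEAR place
bounds.** For an abc triple with `a ≤ b`, `ab > 1` and `a² < c`:
`log c ≤ 1800 C⋆ D K C₁² · R^{7/24} · Λ⁶ · (Λ + Y)²`, with `Λ = max(1, log R)`, `Y = log max{e, 2 log c}`,
`C⋆ = max(1, Cw(2), Cw(3), Cw(4))`, `D = log 6 + log K + 2 log C₁ + 8`, `C₁` the constant of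
`exists_prod_two_mul_max_log_le`.  VERBATIM the proof of `log_le_of_sq_lt_kummer₂_placeBounds` (file VII-B) run in
the generic quantity `Y′ := Λ + Y` in place of `Y`: that proof uses the definition of `Y` only through `1 ≤ Y` and
`log(e(1 + 3 log c)) ≤ 4Y` (both true for `Y′ ≥ Y`), and the place bounds only through
`log_le_of_primes_le_placeBounds` / `logHeight₁_smooth_le_placeBounds`, replaced here by their linear twins (which
output `3τ(Λ + Y)` for `3τY` since `log q ≤ Λ` at every prime `q ∣ abc`).
[cite: StewartYu2001, Theorem 1 (proof), as reconstructed] [cite: Waldschmidt1980, Prop 3.8 (p. 274)] -/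
theorem log_le_of_sq_lt_kummer₂_placeBoundsLin (hK : 1 ≤ K)
    (hpad : ∀ {a b c : ℕ}, IsABCTriple a b c → ∀ {p : ℕ}, p.Prime → p ∣ a →
      (a.factorization p : ℝ) * Real.log p < theta K b c 0 *
        ((p : ℝ) * (Real.log p + Real.log (max (Real.exp 1) (2 * Real.log c)))))
    (hpadc : ∀ {a b c : ℕ}, IsABCTriple a b c → 1 < a * b → ∀ {p : ℕ}, p.Prime → p ∣ c →
      (c.factorization p : ℝ) * Real.log p < theta K a b 0 *
        ((p : ℝ) * (Real.log p + Real.log (max (Real.exp 1) (2 * Real.log c)))))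
    (Cw : ℕ → ℝ) (hCw : ∀ n, 0 ≤ Cw n)
    (hW₂ : ∀ (n : ℕ) (α : Fin (n + 1) → ℚ) (b : Fin (n + 1) → ℤ) (V : Fin (n + 1) → ℝ) (W : ℝ),
      (∀ j, 0 < α j ∧ α j ≠ 1) →
      Module.finrank ℚ ↥(IntermediateField.adjoin ℚ
          (Set.range fun j => Real.sqrt (α j : ℝ))) = 2 ^ (n + 1) →
      Monotone V → 1 ≤ V 0 →
      (∀ j, max (logHeight₁ (α j)) |Real.log (α j : ℝ)| ≤ V j) →
      0 < W → (∀ j, logHeight₁ (b j : ℚ) ≤ W) →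
      ∑ j, (b j : ℝ) * Real.log (α j : ℝ) ≠ 0 →
      Real.exp (-(Cw (n + 1) * (∏ j, V j) * (W + Real.log (2 * V (Fin.last n))) *
          Real.log (2 * (if n = 0 then 1 else V ⟨n - 1, by omega⟩)) / Real.log 2 ^ (n + 2))) <
        |∑ j, (b j : ℝ) * Real.log (α j : ℝ)|)
    {C₁ : ℝ} (hC₁1 : 1 ≤ C₁)
    (hC₁ : ∀ S : Finset ℕ, (∀ p ∈ S, p.Prime) →
      ∏ p ∈ S, 2 * K * max 1 (Real.log p) ≤ C₁ * (∏ p ∈ S, (p : ℝ)) ^ (1 / 48 : ℝ))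
    (h : IsABCTriple a b c) (hab : a ≤ b) (h1 : 1 < a * b) (hac2 : (a : ℝ) ^ 2 < c) :
    Real.log c ≤ 1800 * max 1 (max (max (Cw 2) (Cw 3)) (Cw 4)) *
      (Real.log 6 + Real.log K + 2 * Real.log C₁ + 8) * K * C₁ ^ 2 *
      (rad a b c : ℝ) ^ (7 / 24 : ℝ) * max 1 (Real.log (rad a b c : ℕ)) ^ 6 *
      (max 1 (Real.log (rad a b c : ℕ)) + Real.log (max (Real.exp 1) (2 * Real.log c))) ^ 2 := by
  classical
  obtain ⟨ha, hb, habc, hcop⟩ := id h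
  have hc : c ≠ 0 := by omega
  have hbc : b.Coprime c := coprime_right_of_isABCTriple h
  have hcb : c.Coprime b := hbc.symm
  have hac : a.Coprime c := coprime_left_of_isABCTriple h
  have habc0 : a * b * c ≠ 0 := by positivity
  have hK0 : 0 ≤ K := zero_le_one.trans hK
  have ha_r : (0 : ℝ) < a := by exact_mod_cast ha
  have hb_r : (0 : ℝ) < b := by exact_mod_cast hb
  have hc_r : (0 : ℝ) < c := by exact_mod_cast Nat.pos_of_ne_zero hc
  have hbc_lt : (b : ℝ) < c := by exact_mod_cast (show b < c by omega)
  have hab_r : (a : ℝ) ≤ b := by exact_mod_cast hab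
  -- notation
  set R : ℕ := rad a b c with hRdef
  have hR0n : R ≠ 0 := by
    rw [hRdef, rad_def]; exact UniqueFactorizationMonoid.radical_ne_zero
  have hR1 : (1 : ℝ) ≤ (R : ℝ) := one_le_rad_real a b c
  have hR0 : (0 : ℝ) < R := by linarith
  set Λ : ℝ := max 1 (Real.log (R : ℝ)) with hΛdef
  have hΛ1 : 1 ≤ Λ := le_max_left _ _
  have hΛ0 : 0 < Λ := by linarith
  set τ : ℝ := (R : ℝ) ^ (1 / 4 : ℝ) with hτdef
  have hτ1 : 1 ≤ τ := Real.one_le_rpow hR1 (by norm_num)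
  set y : ℝ := Real.log c with hydef
  have hy0 : 0 < y := Real.log_pos (by exact_mod_cast (show 1 < c by omega))
  set Y : ℝ := Λ + Real.log (max (Real.exp 1) (2 * Real.log c)) with hYdef
  have hY1 : 1 ≤ Y := by
    have h' := one_le_log_max_exp (2 * Real.log c)
    rw [hYdef]; linarith
  set Cmax : ℝ := max (max (Cw 2) (Cw 3)) (Cw 4) with hCmax
  set C' : ℝ := max 1 Cmax with hC'
  have hC'1 : 1 ≤ C' := le_max_left _ _
  have hCle : ∀ n, 2 ≤ n → n ≤ 4 → Cw n ≤ C' := fun n hn2 hn4 => by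
    rw [hC', hCmax]; exact apply_le_max_four Cw hn2 hn4
  set D : ℝ := Real.log 6 + Real.log K + 2 * Real.log C₁ + 8 with hDdef
  have hD1 : 1 ≤ D := by
    have h6 : 0 ≤ Real.log 6 := Real.log_nonneg (by norm_num)
    have hK' : 0 ≤ Real.log K := Real.log_nonneg hK
    have hC₁' : 0 ≤ Real.log C₁ := Real.log_nonneg hC₁1
    rw [hDdef]; linarith
  set J : ℝ := ∏ q ∈ (a * b * c).primeFactors, 2 * K * max 1 (Real.log q) with hJdef
  have hJ1 : 1 ≤ J := one_le_prod_two_mul_max hK _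
  have hΘab : theta K a b 0 ≤ K * J :=
    theta_zero_le_mul_prod hK ha.ne' hb.ne' hcop habc0 (Dvd.intro c rfl)
  have hΘac : theta K a c 0 ≤ K * J :=
    theta_zero_le_mul_prod hK ha.ne' hc hac habc0 (Dvd.intro b (by ring))
  have hΘab0 : 0 ≤ theta K a b 0 := theta_nonneg hK0 a b 0
  have hΘac0 : 0 ≤ theta K a c 0 := theta_nonneg hK0 a c 0
  -- `J ≤ C₁ R^{1/48}`
  have hJle : J ≤ C₁ * (R : ℝ) ^ (1 / 48 : ℝ) := by
    have h1' := hC₁ (a * b * c).primeFactors fun q hq => Nat.prime_of_mem_primeFactors hq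
    have hprod : ∏ q ∈ (a * b * c).primeFactors, (q : ℝ) = R := by
      rw [hRdef, rad_def, Nat.radical_eq_prod_primeFactors, Nat.cast_prod]
    rwa [hprod] at h1'
  -- primes of `cb`, small and large
  set P : Finset ℕ := (c * b).primeFactors with hPdef
  have hcbdvd : c * b ∣ a * b * c := Dvd.intro_left a (by ring)
  have hPsub : P ⊆ (a * b * c).primeFactors := Nat.primeFactors_mono hcbdvd habc0
  have hPprime : ∀ q ∈ P, q.Prime := fun q hq => Nat.prime_of_mem_primeFactors hq
  have hcardP : (P.card : ℝ) ≤ J :=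
    le_trans (by exact_mod_cast Finset.card_le_card hPsub) (card_primeFactors_le_prod hK _)
  set S : Finset ℕ := P.filter (fun q => (q : ℝ) ≤ τ) with hSdef
  set L : Finset ℕ := P.filter (fun q => ¬(q : ℝ) ≤ τ) with hLdef
  have hSsub : S ⊆ P := Finset.filter_subset _ _
  have hLsub : L ⊆ P := Finset.filter_subset _ _
  have hSτ : ∀ q ∈ S, (q : ℝ) ≤ τ := fun q hq => (Finset.mem_filter.mp hq).2
  have hLτ : ∀ q ∈ L, τ < q := fun q hq => lt_of_not_ge (Finset.mem_filter.mp hq).2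
  have hLprime : ∀ q ∈ L, q.Prime := fun q hq => hPprime q (hLsub hq)
  have hcardS : (S.card : ℝ) ≤ J :=
    le_trans (by exact_mod_cast Finset.card_le_card hSsub) hcardP
  -- at most three large primes
  have hL3 : L.card ≤ 3 := by
    refine card_le_three_of_quarter_lt hR0n L ?_ hLτ
    have h1' : ∏ q ∈ L, q ∣ ∏ q ∈ (a * b * c).primeFactors, q :=
      Finset.prod_dvd_prod_of_subset _ _ _ (hLsub.trans hPsub)
    rwa [← Nat.radical_eq_prod_primeFactors, ← rad_def] at h1'
  -- `log q ≤ Λ` on `P`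
  have hlogP : ∀ q ∈ P, Real.log q ≤ Λ := by
    intro q hq
    have hqp := hPprime q hq
    have hqR : (q : ℝ) ≤ R := by
      exact_mod_cast prime_le_rad hqp ((Nat.dvd_of_mem_primeFactors hq).trans hcbdvd) habc0
    exact (Real.log_le_log (by exact_mod_cast hqp.pos) hqR).trans (le_max_right _ _)
  have hcP : c.primeFactors ⊆ P := Nat.primeFactors_mono (Dvd.intro b rfl) (mul_ne_zero hc hb.ne')
  -- the smooth part `β` and the splitting of `c/b`
  set e : ℕ → ℤ := expDiff c b with hedef
  set β : ℚ := ∏ q ∈ S, (q : ℚ) ^ e q with hβdef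
  have hβpos : 0 < β := Finset.prod_pos fun q hq =>
    zpow_pos (by exact_mod_cast (hPprime q (hSsub hq)).pos) _
  have hsplitQ : (c : ℚ) / b = β * ∏ q ∈ L, (q : ℚ) ^ e q := by
    rw [cast_div_eq_prod_zpow hc hb.ne' hcb, hβdef, hSdef, hLdef,
      Finset.prod_filter_mul_prod_filter_not]
  set Λ₀ : ℝ := Real.log c - Real.log b with hΛ₀def
  have hΛ₀eq : Λ₀ = Real.log (β : ℝ) + ∑ q ∈ L, (e q : ℝ) * Real.log q := by
    have hcast : (((c : ℚ) / b : ℚ) : ℝ) = (c : ℝ) / b := by push_cast; rfl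
    have hq0 : ∀ q ∈ L, ((q : ℝ)) ^ e q ≠ 0 := fun q hq =>
      zpow_ne_zero _ (by exact_mod_cast (hLprime q hq).ne_zero)
    have h2 : (((c : ℚ) / b : ℚ) : ℝ) = (β : ℝ) * ∏ q ∈ L, (q : ℝ) ^ e q := by
      rw [hsplitQ]; push_cast; rfl
    have hβr : (β : ℝ) ≠ 0 := by exact_mod_cast hβpos.ne'
    have hprod0 : ∏ q ∈ L, (q : ℝ) ^ e q ≠ 0 := Finset.prod_ne_zero_iff.mpr hq0
    calc Λ₀ = Real.log ((c : ℝ) / b) := (Real.log_div hc_r.ne' hb_r.ne').symm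
      _ = Real.log ((β : ℝ) * ∏ q ∈ L, (q : ℝ) ^ e q) := by rw [← hcast, h2]
      _ = Real.log (β : ℝ) + ∑ q ∈ L, Real.log ((q : ℝ) ^ e q) := by
          rw [Real.log_mul hβr hprod0, Real.log_prod hq0]
      _ = Real.log (β : ℝ) + ∑ q ∈ L, (e q : ℝ) * Real.log q := by
          congr 1
          exact Finset.sum_congr rfl fun q _ => Real.log_zpow _ _
  -- `0 < Λ₀ ≤ a/b ≤ 1`
  have hΛ₀pos : 0 < Λ₀ := by
    rw [hΛ₀def]; linarith only [Real.log_lt_log hb_r hbc_lt]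
  have hΛ₀le : Λ₀ ≤ (a : ℝ) / b := by
    have h1' : Real.log ((c : ℝ) / b) ≤ (c : ℝ) / b - 1 := Real.log_le_sub_one_of_pos (by positivity)
    have h2 : (c : ℝ) / b - 1 = (a : ℝ) / b := by
      have : (c : ℝ) = a + b := by exact_mod_cast habc.symm
      rw [this, add_div, div_self hb_r.ne']; ring
    rw [hΛ₀def, ← Real.log_div hc_r.ne' hb_r.ne']
    linarith only [h1', h2]
  have hab1 : (a : ℝ) / b ≤ 1 := (div_le_one hb_r).mpr hab_r
  -- `y < 2 + 2 · (−log Λ₀)`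
  have hstar : y < 2 + 2 * (-Real.log Λ₀) := by
    have h2a : 2 * Real.log a < y := by
      have h' : Real.log ((a : ℝ) ^ 2) < Real.log c := Real.log_lt_log (by positivity) hac2
      have h'' : Real.log ((a : ℝ) ^ 2) = 2 * Real.log a := by
        rw [Real.log_pow]; push_cast; ring
      rw [hydef]; linarith only [h', h'']
    have hlogΛ₀ : Real.log Λ₀ ≤ Real.log a - Real.log b := by
      rw [← Real.log_div ha_r.ne' hb_r.ne']
      exact Real.log_le_log hΛ₀pos hΛ₀le
    have hΛ₀1 : Λ₀ ≤ 1 := hΛ₀le.trans hab1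
    have hyΛ : y - Real.log a = Λ₀ + (Real.log b - Real.log a) := by rw [hΛ₀def]; ring
    linarith only [h2a, hlogΛ₀, hΛ₀1, hyΛ]
  -- exponents: `|e_q| ≤ 1 + 3y`
  set Bₑ : ℝ := 1 + 3 * y with hBₑdef
  have hBₑ1 : 1 ≤ Bₑ := by rw [hBₑdef]; linarith
  have hBₑ : ∀ q ∈ L, (|e q| : ℝ) ≤ Bₑ := by
    intro q hq
    have hqp := hLprime q hq
    have hnat : (|e q| : ℝ) = ((expDiff c b q).natAbs : ℝ) := by
      rw [Nat.cast_natAbs, Int.cast_abs]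
    rw [hnat, natAbs_expDiff hc hb.ne' hcb q]
    have h1' := factorization_le_log (mul_ne_zero hc hb.ne') hqp
    have h2 : Real.log ((c * b : ℕ) : ℝ) ≤ 2 * y := by
      push_cast
      rw [Real.log_mul hc_r.ne' hb_r.ne', hydef]
      linarith only [Real.log_le_log hb_r hbc_lt.le]
    have h3 : (0 : ℝ) ≤ y := hy0.le
    rw [hBₑdef]; linarith only [h1', h2, h3]
  have hlogBₑ : Real.log (Real.exp 1 * Bₑ) ≤ 4 * Y := by
    have h' := log_exp_mul_le_four_mul hy0.le
    rw [hBₑdef, hYdef]; linarith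
  have he2 : (2 : ℝ) ≤ Real.exp 1 := by have := Real.add_one_le_exp (1 : ℝ); linarith
  have hlogBₑ0 : 0 ≤ Real.log (Real.exp 1 * Bₑ) :=
    Real.log_nonneg (one_le_mul_of_one_le_of_one_le (by linarith) hBₑ1)
  -- `(log 2)^{-(k+2)} ≤ 32`, `(log 2)^{-(k+1)} ≤ 16` for `k ≤ 3`
  have hlog2 : 0 < Real.log 2 := Real.log_pos one_lt_two
  have hinv : ∀ k, k ≤ 3 → 1 / Real.log 2 ^ (k + 2) ≤ 32 := fun k hk => by
    calc 1 / Real.log 2 ^ (k + 2) ≤ 2 ^ (k + 2) := inv_log_two_pow_le _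
      _ ≤ 2 ^ 5 := pow_le_pow_right₀ (by norm_num) (by omega)
      _ = 32 := by norm_num
  have hinv' : ∀ k, k ≤ 3 → 1 / Real.log 2 ^ (k + 1) ≤ 16 := fun k hk => by
    calc 1 / Real.log 2 ^ (k + 1) ≤ 2 ^ (k + 1) := inv_log_two_pow_le _
      _ ≤ 2 ^ 4 := pow_le_pow_right₀ (by norm_num) (by omega)
      _ = 16 := by norm_num
  have hlog2Λ : Real.log (2 * Λ) ≤ 2 * Λ := log_two_mul_le hΛ1
  have hlog2Λ0 : 0 ≤ Real.log (2 * Λ) := Real.log_nonneg (by linarith)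
  have hΛpow : ∀ k, k ≤ 3 → Λ ^ k ≤ Λ ^ 3 := fun k hk => pow_le_pow_right₀ hΛ1 hk
  -- the target of all cases
  set Pₘ : ℝ := C' * D * K * J ^ 2 * τ * Λ ^ 6 with hPₘ
  set M : ℝ := 1800 * Pₘ with hMdef
  have hMeq : 1800 * (C' * D * K * J ^ 2 * τ * Λ ^ 6) * Y ^ 2 = M * Y ^ 2 := by rw [hMdef]
  have hyM : y ≤ M * Y ^ 2 := by
    rcases Finset.eq_empty_or_nonempty L with hLe | hLne
    · -- every prime of `cb` is small: bound `log c` through the primes of `c` directly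
      have hsmall : ∀ q ∈ c.primeFactors, (q : ℝ) ≤ τ := by
        intro q hq
        have hqP : q ∈ P := Nat.primeFactors_mono (Dvd.intro b rfl) (mul_ne_zero hc hb.ne') hq
        by_contra hqτ
        have : q ∈ L := Finset.mem_filter.mpr ⟨hqP, hqτ⟩
        rw [hLe] at this
        exact Finset.notMem_empty q this
      have h1' := log_le_of_primes_le_placeBoundsLin hK hpadc h h1 hsmall fun q hq => hlogP q (hcP hq)
      have hsubc : c.primeFactors ⊆ (a * b * c).primeFactors :=
        Nat.primeFactors_mono (Dvd.intro_left (a * b) rfl) habc0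
      have hcardc : (c.primeFactors.card : ℝ) ≤ J :=
        le_trans (by exact_mod_cast Finset.card_le_card hsubc) (card_primeFactors_le_prod hK _)
      obtain ⟨-, hA2, -, -, -⟩ := regimeIIK_arith (Hs := 1 + 6 * K * J ^ 2 * τ * Y) hC'1 hD1 hK
        hJ1 hτ1 hΛ1 hY1 le_rfl
      calc y ≤ c.primeFactors.card * (theta K a b 0 * (3 * τ * Y)) := h1'
        _ ≤ J * (K * J * (3 * τ * Y)) := by
            apply mul_le_mul hcardc _ (by positivity) (zero_le_one.trans hJ1)
            exact mul_le_mul_of_nonneg_right hΘab (by positivity)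
        _ = 3 * (K * J ^ 2 * τ) * Y := by ring
        _ ≤ 1800 * (C' * D * K * J ^ 2 * τ * Λ ^ 6) * Y ^ 2 := hA2
        _ = M * Y ^ 2 := hMeq
    · rcases eq_or_ne β 1 with hβ1 | hβ1
      · -- `Λ₀ = ∑_{q ∈ L} e_q log q`
        have hΛ₀eq' : Λ₀ = ∑ q ∈ L, (e q : ℝ) * Real.log q := by
          rw [hΛ₀eq, hβ1]; push_cast; rw [Real.log_one, zero_add]
        rcases le_or_gt 2 L.card with hL2 | hL2
        · have hne : ∑ q ∈ L, (e q : ℝ) * Real.log q ≠ 0 := by rw [← hΛ₀eq']; exact hΛ₀pos.ne'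
          have key := kummer_arch_lower_bound_primes₂ Cw hCw hW₂ L hLprime (by omega) e hΛ1
            (fun q hq => hlogP q (hLsub hq)) hBₑ1 hBₑ hne
          rw [← hΛ₀eq', abs_of_pos hΛ₀pos] at key
          -- `−log Λ₀ < Cw(#L) Λ^{#L} (log(eBₑ) + log 2Λ) log 2Λ / (log 2)^{#L+1} ≤ 192 C' Λ⁵ Y`
          have hCn : Cw L.card ≤ C' := hCle _ hL2 (by omega)
          have hCn0 : 0 ≤ Cw L.card := hCw _
          have hneg : -Real.log Λ₀ ≤ 192 * C' * Λ ^ 5 * Y := by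
            have hsum : Real.log (Real.exp 1 * Bₑ) + Real.log (2 * Λ) ≤ 6 * Λ * Y := by
              have h1' : 2 * Λ ≤ 2 * Λ * Y := le_mul_of_one_le_right (by linarith) hY1
              have h2' : Y ≤ Λ * Y := le_mul_of_one_le_left (by linarith) hΛ1
              have h3' : 6 * Λ * Y = 2 * Λ * Y + 4 * (Λ * Y) := by ring
              linarith only [h1', h2', h3', hlogBₑ, hlog2Λ]
            have hsum0 : 0 ≤ Real.log (Real.exp 1 * Bₑ) + Real.log (2 * Λ) := by linarith
            have h' : Cw L.card * Λ ^ L.card * (Real.log (Real.exp 1 * Bₑ) + Real.log (2 * Λ)) *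
                Real.log (2 * Λ) / Real.log 2 ^ (L.card + 1) ≤
                C' * Λ ^ 3 * (6 * Λ * Y) * (2 * Λ) * 16 := by
              rw [div_eq_mul_one_div]
              apply mul_le_mul _ (hinv' _ hL3) (by positivity) (by positivity)
              apply mul_le_mul _ hlog2Λ hlog2Λ0 (by positivity)
              exact mul_le_mul (mul_le_mul hCn (hΛpow _ hL3) (by positivity) (by positivity))
                hsum hsum0 (by positivity)
            have h'' : C' * Λ ^ 3 * (6 * Λ * Y) * (2 * Λ) * 16 = 192 * C' * Λ ^ 5 * Y := by ring
            linarith only [h', h'', key]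
          obtain ⟨-, -, -, hA4, -⟩ := regimeIIK_arith (Hs := 1 + 6 * K * J ^ 2 * τ * Y) hC'1 hD1
            hK hJ1 hτ1 hΛ1 hY1 le_rfl
          calc y ≤ 2 + 2 * (192 * C' * Λ ^ 5 * Y) := by linarith only [hstar, hneg]
            _ ≤ 1800 * (C' * D * K * J ^ 2 * τ * Λ ^ 6) * Y ^ 2 := hA4
            _ = M * Y ^ 2 := hMeq
        · -- exactly one large prime and `β = 1`: `Λ₀ = e log q₀ ≥ 1/2`
          have hL1 : L.card = 1 := by have := hLne.card_pos; omega
          obtain ⟨q₀, hLq₀⟩ := Finset.card_eq_one.mp hL1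
          have hq₀L : q₀ ∈ L := by rw [hLq₀]; exact Finset.mem_singleton_self q₀
          have hq₀p := hLprime q₀ hq₀L
          have hΛ₀q : Λ₀ = (e q₀ : ℝ) * Real.log q₀ := by rw [hΛ₀eq', hLq₀, Finset.sum_singleton]
          have hlogq₀ : Real.log 2 ≤ Real.log q₀ :=
            Real.log_le_log two_pos (by exact_mod_cast hq₀p.two_le)
          have hlog2' : (1 / 2 : ℝ) < Real.log 2 := by have := Real.log_two_gt_d9; linarith
          have hlogq₀0 : 0 < Real.log q₀ := by linarith only [hlogq₀, hlog2']
          have he1 : (1 : ℝ) ≤ e q₀ := by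
            have hpos : (0 : ℝ) < e q₀ := by
              by_contra hle
              push Not at hle
              have h' : Λ₀ ≤ 0 := by rw [hΛ₀q]; exact mul_nonpos_of_nonpos_of_nonneg hle hlogq₀0.le
              linarith only [h', hΛ₀pos]
            exact_mod_cast (show (1 : ℤ) ≤ e q₀ by exact_mod_cast hpos)
          have hΛ₀ge : 1 / 2 ≤ Λ₀ := by
            rw [hΛ₀q]
            calc (1 / 2 : ℝ) ≤ 1 * Real.log q₀ := by linarith only [hlogq₀, hlog2']
              _ ≤ (e q₀ : ℝ) * Real.log q₀ := mul_le_mul_of_nonneg_right he1 hlogq₀0.le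
          have hneg : -Real.log Λ₀ ≤ 1 := by
            have h' : Real.log (1 / 2) ≤ Real.log Λ₀ := Real.log_le_log (by norm_num) hΛ₀ge
            have h12 : Real.log (1 / 2) = -Real.log 2 := by
              rw [one_div, Real.log_inv]
            have h2 := Real.log_two_lt_d9
            linarith only [h', h12, h2]
          obtain ⟨-, -, hA3, -, -⟩ := regimeIIK_arith (Hs := 1 + 6 * K * J ^ 2 * τ * Y) hC'1 hD1
            hK hJ1 hτ1 hΛ1 hY1 le_rfl
          calc y ≤ 4 := by linarith only [hstar, hneg]
            _ ≤ 1800 * (C' * D * K * J ^ 2 * τ * Λ ^ 6) * Y ^ 2 := hA3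
            _ = M * Y ^ 2 := hMeq
      · -- `β ≠ 1`: the archimedean bound with generators `L ∪ {β₀}`, `β = β₀^{2ʲ}`
        obtain ⟨β₀, j, hβ₀pos, hβ₀1, hβ₀sq, hββ₀⟩ := exists_eq_pow_two_pow_of_pos hβpos hβ1
        -- `log β = 2ʲ log β₀`
        have hlogβ : Real.log (β : ℝ) = ((2 ^ j : ℕ) : ℤ) * Real.log (β₀ : ℝ) := by
          rw [hββ₀, Rat.cast_pow, Real.log_pow]; push_cast; ring
        have hne : ((2 ^ j : ℕ) : ℤ) * Real.log (β₀ : ℝ) + ∑ q ∈ L, (e q : ℝ) * Real.log q ≠ 0 := by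
          have : (((2 ^ j : ℕ) : ℤ) : ℝ) * Real.log (β₀ : ℝ) = Real.log (β : ℝ) := by
            rw [hlogβ]
          rw [this, ← hΛ₀eq]; exact hΛ₀pos.ne'
        -- `β₀` is a unit at the large primes
        have hν : ∀ p ∈ L, padicValRat p β₀ = 0 := by
          intro p hp
          have hpp : p.Prime := hLprime p hp
          haveI : Fact p.Prime := ⟨hpp⟩
          have hpS : p ∉ S := fun hpS => (not_le.mpr (hLτ p hp)) (hSτ p hpS)
          have hvβ : padicValRat p β = 0 := by
            rw [hβdef, padicValRat_finset_prod p S _ (fun q hq =>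
              zpow_ne_zero _ (by exact_mod_cast (hPprime q (hSsub hq)).ne_zero))]
            refine Finset.sum_eq_zero fun q hq => ?_
            have hqp : q.Prime := hPprime q (hSsub hq)
            haveI : Fact q.Prime := ⟨hqp⟩
            have hpq : p ≠ q := fun h => hpS (h ▸ hq)
            rw [padicValRat.zpow, padicValRat.of_nat, padicValNat_primes hpq]
            simp
          rw [hββ₀, padicValRat.pow] at hvβ
          rcases mul_eq_zero.mp hvβ with h0 | h0
          · exact absurd h0 (by positivity)
          · exact h0
        -- heights: `h(β₀) ≤ h(β) ≤ 6 K J² τ Y`, `2ʲ ≤ 2 h(β)`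
        set Hs : ℝ := max 1 (logHeight₁ β) with hHsdef
        have hHs1 : 1 ≤ Hs := le_max_left _ _
        have hhβ := logHeight₁_smooth_le_placeBoundsLin hK hpad hpadc h h1 S hSsub hSτ
          fun q hq => hlogP q (hSsub hq)
        have h6 : logHeight₁ β ≤ 6 * K * J ^ 2 * τ * Y := by
          calc logHeight₁ β ≤ S.card * ((theta K a b 0 + theta K a c 0) * (3 * τ * Y)) := hhβ
            _ ≤ J * ((K * J + K * J) * (3 * τ * Y)) := by
                apply mul_le_mul hcardS _ (by positivity) (zero_le_one.trans hJ1)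
                exact mul_le_mul_of_nonneg_right (add_le_add hΘab hΘac) (by positivity)
            _ = 6 * K * J ^ 2 * τ * Y := by ring
        have h60 : 0 ≤ 6 * K * J ^ 2 * τ * Y := by positivity
        have hh0 : 0 ≤ logHeight₁ β := zero_le_logHeight₁ _
        have hHsle : Hs ≤ 1 + 6 * K * J ^ 2 * τ * Y :=
          max_le (by linarith only [h60]) (by linarith only [h6, hh0])
        have hββ₀h : logHeight₁ β = (2 ^ j : ℕ) * logHeight₁ β₀ := by
          rw [hββ₀, logHeight₁_pow]
        have hh₀pos : Real.log 2 ≤ logHeight₁ β₀ := log_two_le_logHeight₁ hβ₀pos hβ₀1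
        have hlog2' : (1 / 2 : ℝ) < Real.log 2 := by have := Real.log_two_gt_d9; linarith
        have h2j : ((2 ^ j : ℕ) : ℝ) ≤ 2 * logHeight₁ β := by
          rw [hββ₀h]
          have : (0 : ℝ) ≤ (2 ^ j : ℕ) := by positivity
          nlinarith
        have hh₀le : logHeight₁ β₀ ≤ logHeight₁ β := by
          rw [hββ₀h]
          have h1' : (1 : ℝ) ≤ (2 ^ j : ℕ) := by exact_mod_cast Nat.one_le_two_pow
          have : 0 ≤ logHeight₁ β₀ := zero_le_logHeight₁ _
          nlinarith
        -- the coefficients bound `B = Bₑ (1 + 2 h(β))`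
        set B : ℝ := Bₑ * (1 + 2 * logHeight₁ β) with hBdef
        have hB1' : 1 ≤ 1 + 2 * logHeight₁ β := by linarith
        have hB1 : 1 ≤ B := one_le_mul_of_one_le_of_one_le hBₑ1 hB1'
        have hBₑB : Bₑ ≤ B := le_mul_of_one_le_right (by linarith) hB1'
        have hBe : ∀ p ∈ L, (|e p| : ℝ) ≤ B := fun p hp => (hBₑ p hp).trans hBₑB
        have hBm : (|((2 ^ j : ℕ) : ℤ)| : ℝ) ≤ B := by
          have : (|((2 ^ j : ℕ) : ℤ)| : ℝ) = ((2 ^ j : ℕ) : ℝ) := by push_cast; exact abs_of_nonneg (by positivity)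
          rw [this]
          calc ((2 ^ j : ℕ) : ℝ) ≤ 1 + 2 * logHeight₁ β := by linarith
            _ = 1 * (1 + 2 * logHeight₁ β) := (one_mul _).symm
            _ ≤ Bₑ * (1 + 2 * logHeight₁ β) := mul_le_mul_of_nonneg_right hBₑ1 (by linarith)
        have key := kummer_arch_lower_bound₂ Cw hCw hW₂ L hLprime e hβ₀pos hβ₀1 hβ₀sq hν
          ((2 ^ j : ℕ) : ℤ) hΛ1 (fun q hq => hlogP q (hLsub hq)) hB1 hBe hBm hne
        have hΛ₀eq'' : Λ₀ = (((2 ^ j : ℕ) : ℤ) : ℝ) * Real.log (β₀ : ℝ) +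
            ∑ q ∈ L, (e q : ℝ) * Real.log q := by rw [hΛ₀eq, hlogβ]
        rw [← hΛ₀eq'', abs_of_pos hΛ₀pos] at key
        have hL2 : 2 ≤ L.card + 1 := by have := hLne.card_pos; omega
        have hCn : Cw (L.card + 1) ≤ C' := hCle _ hL2 (by omega)
        have hCn0 : 0 ≤ Cw (L.card + 1) := hCw _
        -- the pieces: `H = max(h(β₀), Λ) ≤ Λ Hs`, the logarithms `≤ D Λ Y`
        set H : ℝ := max (logHeight₁ β₀) Λ with hHdef
        have hH1 : 1 ≤ H := hΛ1.trans (le_max_right _ _)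
        have hHle : H ≤ Λ * Hs := by
          refine max_le ?_ (le_mul_of_one_le_right hΛ0.le hHs1)
          calc logHeight₁ β₀ ≤ logHeight₁ β := hh₀le
            _ ≤ Hs := le_max_right _ _
            _ = 1 * Hs := (one_mul _).symm
            _ ≤ Λ * Hs := mul_le_mul_of_nonneg_right hΛ1 (by linarith)
        have hHle' : H ≤ Λ * (1 + 6 * K * J ^ 2 * τ * Y) :=
          hHle.trans (mul_le_mul_of_nonneg_left hHsle hΛ0.le)
        obtain ⟨hlogB, hlogH⟩ := regimeIIK_logs (h := logHeight₁ β) hK hJ1 hC₁1 hR1 rfl hJle rfl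
          hY1 hy0.le hlogBₑ hh0 h6
        have hlogB' : Real.log (Real.exp 1 * B) ≤ D * Λ * Y := by rw [hBdef, hBₑdef]; exact hlogB
        have hlog2H : Real.log (2 * H) ≤ D * Λ * Y := by
          have : Real.log (2 * H) ≤ Real.log (2 * (Λ * (1 + 6 * K * J ^ 2 * τ * Y))) :=
            Real.log_le_log (by linarith) (by linarith)
          exact this.trans hlogH
        have hsum : Real.log (Real.exp 1 * B) + Real.log (2 * H) ≤ 2 * D * Λ * Y := by linarith
        have hsum0 : 0 ≤ Real.log (Real.exp 1 * B) + Real.log (2 * H) := by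
          have h1' : 0 ≤ Real.log (Real.exp 1 * B) :=
            Real.log_nonneg (one_le_mul_of_one_le_of_one_le (by linarith) hB1)
          have h2' : 0 ≤ Real.log (2 * H) := Real.log_nonneg (by linarith)
          linarith
        have hneg : -Real.log Λ₀ ≤ 128 * C' * D * Λ ^ 6 * Hs * Y := by
          have h' : Cw (L.card + 1) * (Λ ^ L.card * H) *
              (Real.log (Real.exp 1 * B) + Real.log (2 * H)) * Real.log (2 * Λ) /
              Real.log 2 ^ (L.card + 2) ≤
              C' * (Λ ^ 3 * (Λ * Hs)) * (2 * D * Λ * Y) * (2 * Λ) * 32 := by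
            rw [div_eq_mul_one_div]
            apply mul_le_mul _ (hinv _ hL3) (by positivity) (by positivity)
            apply mul_le_mul _ hlog2Λ hlog2Λ0 (by positivity)
            apply mul_le_mul _ hsum hsum0 (by positivity)
            exact mul_le_mul hCn (mul_le_mul (hΛpow _ hL3) hHle (by positivity) (by positivity))
              (by positivity) (by positivity)
          have h'' : C' * (Λ ^ 3 * (Λ * Hs)) * (2 * D * Λ * Y) * (2 * Λ) * 32 =
              128 * C' * D * Λ ^ 6 * Hs * Y := by ring
          linarith only [h', h'', key]
        obtain ⟨-, -, -, -, hA5⟩ := regimeIIK_arith hC'1 hD1 hK hJ1 hτ1 hΛ1 hY1 hHsle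
        calc y ≤ 2 + 2 * (128 * C' * D * Λ ^ 6 * Hs * Y) := by linarith only [hstar, hneg]
          _ ≤ 1800 * (C' * D * K * J ^ 2 * τ * Λ ^ 6) * Y ^ 2 := hA5
          _ = M * Y ^ 2 := hMeq
  -- absorb `J² τ ≤ C₁² R^{7/24}`
  have hJ2τ : J ^ 2 * τ ≤ C₁ ^ 2 * (R : ℝ) ^ (7 / 24 : ℝ) := by
    have h48 : ((R : ℝ) ^ (1 / 48 : ℝ)) ^ 2 * (R : ℝ) ^ (1 / 4 : ℝ) = (R : ℝ) ^ (7 / 24 : ℝ) := by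
      rw [← Real.rpow_mul_natCast hR0.le, ← Real.rpow_add hR0]; norm_num
    calc J ^ 2 * τ ≤ (C₁ * (R : ℝ) ^ (1 / 48 : ℝ)) ^ 2 * τ :=
          mul_le_mul_of_nonneg_right (pow_le_pow_left₀ (zero_le_one.trans hJ1) hJle 2)
            (zero_le_one.trans hτ1)
      _ = C₁ ^ 2 * (((R : ℝ) ^ (1 / 48 : ℝ)) ^ 2 * (R : ℝ) ^ (1 / 4 : ℝ)) := by rw [hτdef]; ring
      _ = C₁ ^ 2 * (R : ℝ) ^ (7 / 24 : ℝ) := by rw [h48]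
  have hD0 : 0 ≤ D := zero_le_one.trans hD1
  calc y ≤ M * Y ^ 2 := hyM
    _ = 1800 * C' * D * K * (J ^ 2 * τ) * Λ ^ 6 * Y ^ 2 := by rw [hMdef, hPₘ]; ring
    _ ≤ 1800 * C' * D * K * (C₁ ^ 2 * (R : ℝ) ^ (7 / 24 : ℝ)) * Λ ^ 6 * Y ^ 2 := by
        apply mul_le_mul_of_nonneg_right _ (by positivity)
        apply mul_le_mul_of_nonneg_right _ (by positivity)
        exact mul_le_mul_of_nonneg_left hJ2τ (by positivity)
    _ = 1800 * max 1 (max (max (Cw 2) (Cw 3)) (Cw 4)) *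
          (Real.log 6 + Real.log K + 2 * Real.log C₁ + 8) * K * C₁ ^ 2 *
          (rad a b c : ℝ) ^ (7 / 24 : ℝ) * max 1 (Real.log (rad a b c : ℕ)) ^ 6 * Y ^ 2 := by
        rw [hC', hCmax, hDdef, hΛdef, hRdef]; ring

end RegimeTwoLinearPlaceBounds

section AssemblyLinearPlaceBounds

variable {K : ℝ}

/-- **Endgame of the second regime, linear version** (pure analysis): if `R ≥ 2`, `M₀ ≥ 1` and
`y ≤ M₀ R^{7/24} Λ⁶ (Λ + Y)²` with `Λ = max(1, log R)`, `Y = log max{e, 2y}`, then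
`y ≤ 32·240⁵ · (4M₀) (log(32·4M₀) + 7)² · R^{1/3} (log R)³`.  Proof: if `Y ≤ Λ` then `(Λ + Y)² ≤ 4Λ²` and
`Λ⁸ = Λ³ Λ⁵ ≤ 8 (log R)³ · 240⁵ R^{1/24}` (`Λ ≤ 2 log R`, `Λ ≤ 240 R^{1/240}`), so `y ≤ 32·240⁵ M₀ R^{1/3} (log R)³`;
if `Λ < Y` then `(Λ + Y)² ≤ 4Y²` and `regimeII_endgame6` applies with `4M₀`.
[cite: StewartYu2001, Theorem 1 (proof, §3), as reconstructed] -/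
theorem regimeII_endgame6_lin {y R M₀ : ℝ} (hM₀ : 1 ≤ M₀) (hR : 2 ≤ R)
    (h : y ≤ M₀ * R ^ (7 / 24 : ℝ) * max 1 (Real.log R) ^ 6 *
      (max 1 (Real.log R) + Real.log (max (Real.exp 1) (2 * y))) ^ 2) :
    y ≤ 32 * 240 ^ 5 * (4 * M₀) * (Real.log (32 * (4 * M₀)) + 7) ^ 2 * R ^ (1 / 3 : ℝ) *
      Real.log R ^ 3 := by
  set L : ℝ := Real.log R with hL
  set Λ : ℝ := max 1 L with hΛ
  set Y : ℝ := Real.log (max (Real.exp 1) (2 * y)) with hYdef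
  have hR0 : 0 < R := by linarith
  have hR1 : 1 ≤ R := by linarith
  have hΛ1 : 1 ≤ Λ := le_max_left _ _
  have hΛ0 : 0 < Λ := by linarith
  have hY1 : 1 ≤ Y := one_le_log_max_exp _
  have h4M₀ : 1 ≤ 4 * M₀ := by linarith
  have hM₀0 : 0 ≤ M₀ := by linarith
  rcases le_or_gt Y Λ with hYΛ | hΛY
  · -- `Y ≤ Λ`
    have h2 : (Λ + Y) ^ 2 ≤ (2 * Λ) ^ 2 := pow_le_pow_left₀ (by linarith) (by linarith) 2
    have hy : y ≤ 4 * M₀ * R ^ (7 / 24 : ℝ) * Λ ^ 3 * Λ ^ 5 := by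
      calc y ≤ M₀ * R ^ (7 / 24 : ℝ) * Λ ^ 6 * (Λ + Y) ^ 2 := h
        _ ≤ M₀ * R ^ (7 / 24 : ℝ) * Λ ^ 6 * (2 * Λ) ^ 2 :=
            mul_le_mul_of_nonneg_left h2 (by positivity)
        _ = 4 * M₀ * R ^ (7 / 24 : ℝ) * Λ ^ 3 * Λ ^ 5 := by ring
    -- `Λ ≤ 240 R^{1/240}` and `Λ ≤ 2 L`
    have hΛ240 : Λ ≤ 240 * R ^ (1 / 240 : ℝ) := by
      refine max_le ?_ ?_
      · have : 1 ≤ R ^ (1 / 240 : ℝ) := Real.one_le_rpow hR1 (by norm_num)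
        linarith
      · have := Real.log_le_rpow_div hR0.le (show (0 : ℝ) < 1 / 240 by norm_num)
        rw [hL]; linarith [show R ^ (1 / 240 : ℝ) / (1 / 240) = 240 * R ^ (1 / 240 : ℝ) by ring]
    have hL2 : Real.log 2 ≤ L := Real.log_le_log two_pos hR
    have hlog2 : (1 / 2 : ℝ) ≤ Real.log 2 := by have := Real.log_two_gt_d9; linarith
    have hL0 : 0 ≤ L := by linarith
    have hΛL : Λ ≤ 2 * L := max_le (by linarith) (by linarith)
    have hΛ5 : Λ ^ 5 ≤ 240 ^ 5 * R ^ (1 / 24 : ℝ) := by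
      have h5 : (R ^ (1 / 240 : ℝ)) ^ 5 = R ^ (1 / 48 : ℝ) := by
        rw [← Real.rpow_mul_natCast hR0.le]; norm_num
      have h48 : R ^ (1 / 48 : ℝ) ≤ R ^ (1 / 24 : ℝ) :=
        Real.rpow_le_rpow_of_exponent_le hR1 (by norm_num)
      calc Λ ^ 5 ≤ (240 * R ^ (1 / 240 : ℝ)) ^ 5 := pow_le_pow_left₀ hΛ0.le hΛ240 5
        _ = 240 ^ 5 * R ^ (1 / 48 : ℝ) := by rw [mul_pow, h5]
        _ ≤ 240 ^ 5 * R ^ (1 / 24 : ℝ) := mul_le_mul_of_nonneg_left h48 (by positivity)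
    have hΛ3 : Λ ^ 3 ≤ 8 * L ^ 3 := by
      calc Λ ^ 3 ≤ (2 * L) ^ 3 := pow_le_pow_left₀ hΛ0.le hΛL 3
        _ = 8 * L ^ 3 := by ring
    have hRR : R ^ (7 / 24 : ℝ) * R ^ (1 / 24 : ℝ) = R ^ (1 / 3 : ℝ) := by
      rw [← Real.rpow_add hR0]; norm_num
    -- the constant: `1 ≤ (log(128 M₀) + 7)²`, `M₀ ≤ 4 M₀`
    have hc₀0 : 0 ≤ Real.log (32 * (4 * M₀)) := Real.log_nonneg (by linarith)
    have hc1 : (1 : ℝ) ≤ (Real.log (32 * (4 * M₀)) + 7) ^ 2 := by nlinarith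
    calc y ≤ 4 * M₀ * R ^ (7 / 24 : ℝ) * Λ ^ 3 * Λ ^ 5 := hy
      _ ≤ 4 * M₀ * R ^ (7 / 24 : ℝ) * (8 * L ^ 3) * (240 ^ 5 * R ^ (1 / 24 : ℝ)) := by
          apply mul_le_mul _ hΛ5 (by positivity) (by positivity)
          exact mul_le_mul_of_nonneg_left hΛ3 (by positivity)
      _ = 32 * 240 ^ 5 * M₀ * 1 * (R ^ (7 / 24 : ℝ) * R ^ (1 / 24 : ℝ)) * L ^ 3 := by ring
      _ = 32 * 240 ^ 5 * M₀ * 1 * R ^ (1 / 3 : ℝ) * L ^ 3 := by rw [hRR]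
      _ ≤ 32 * 240 ^ 5 * (4 * M₀) * (Real.log (32 * (4 * M₀)) + 7) ^ 2 * R ^ (1 / 3 : ℝ) *
            L ^ 3 := by
          apply mul_le_mul_of_nonneg_right _ (by positivity)
          apply mul_le_mul_of_nonneg_right _ (by positivity)
          exact mul_le_mul (mul_le_mul_of_nonneg_left (by linarith) (by positivity)) hc1
            zero_le_one (by positivity)
  · -- `Λ < Y`: `(Λ + Y)² ≤ 4 Y²`, and `regimeII_endgame6` with `4 M₀`
    have h2 : (Λ + Y) ^ 2 ≤ (2 * Y) ^ 2 := pow_le_pow_left₀ (by linarith) (by linarith) 2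
    have h' : y ≤ 4 * M₀ * R ^ (7 / 24 : ℝ) * max 1 (Real.log R) ^ 6 *
        Real.log (max (Real.exp 1) (2 * y)) ^ 2 := by
      calc y ≤ M₀ * R ^ (7 / 24 : ℝ) * Λ ^ 6 * (Λ + Y) ^ 2 := h
        _ ≤ M₀ * R ^ (7 / 24 : ℝ) * Λ ^ 6 * (2 * Y) ^ 2 :=
            mul_le_mul_of_nonneg_left h2 (by positivity)
        _ = 4 * M₀ * R ^ (7 / 24 : ℝ) * Λ ^ 6 * Y ^ 2 := by ring
    exact regimeII_endgame6 h4M₀ hR h'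

/-- **Stewart–Yu's `(1/3, 3)` from the two LINEAR `p`-adic place bounds and the `E = 2` form of a Kummer-conditional
archimedean bound with arbitrary constants.** If, for some absolute `K ≥ 1`, the linear place bounds
`ν_p(a) log p < Θ_{bc} · p (log p + Y)` (p ∣ a) and `ν_p(c) log p < Θ_{ab} · p (log p + Y)` (p ∣ c, `ab > 1`) hold for
all abc triples, and linear forms in `≤ 4` logarithms of positive rationals satisfying the `2`-Kummer condition admit
ANY lower bound of the shape of Waldschmidt's Proposition 3.8 (constants `Cw(n) ≥ 0`), then `BakerShapeBound (1/3) 3`: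
`log c ≤ κ R^{1/3} (log R)³` for all abc triples.  Proof: w.l.o.g. `a ≤ b`; the triple `1 + 1 = 2` directly; if
`c ≤ a²`, `log_le_of_le_sq_placeBoundsLin`; if `a² < c`, `log_le_of_sq_lt_kummer₂_placeBoundsLin` and
`regimeII_endgame6_lin`. [cite: StewartYu2001, Theorem 1] [cite: Waldschmidt1980, Prop 3.8 (p. 274)] -/
theorem bakerShapeBound_third_three_of_placeBoundsLin_kummerArchBound₂ (hK : 1 ≤ K)
    (hpad : ∀ {a b c : ℕ}, IsABCTriple a b c → ∀ {p : ℕ}, p.Prime → p ∣ a →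
      (a.factorization p : ℝ) * Real.log p < theta K b c 0 *
        ((p : ℝ) * (Real.log p + Real.log (max (Real.exp 1) (2 * Real.log c)))))
    (hpadc : ∀ {a b c : ℕ}, IsABCTriple a b c → 1 < a * b → ∀ {p : ℕ}, p.Prime → p ∣ c →
      (c.factorization p : ℝ) * Real.log p < theta K a b 0 *
        ((p : ℝ) * (Real.log p + Real.log (max (Real.exp 1) (2 * Real.log c)))))
    (Cw : ℕ → ℝ) (hCw : ∀ n, 0 ≤ Cw n)
    (hW₂ : ∀ (n : ℕ) (α : Fin (n + 1) → ℚ) (b : Fin (n + 1) → ℤ) (V : Fin (n + 1) → ℝ) (W : ℝ),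
      (∀ j, 0 < α j ∧ α j ≠ 1) →
      Module.finrank ℚ ↥(IntermediateField.adjoin ℚ
          (Set.range fun j => Real.sqrt (α j : ℝ))) = 2 ^ (n + 1) →
      Monotone V → 1 ≤ V 0 →
      (∀ j, max (logHeight₁ (α j)) |Real.log (α j : ℝ)| ≤ V j) →
      0 < W → (∀ j, logHeight₁ (b j : ℚ) ≤ W) →
      ∑ j, (b j : ℝ) * Real.log (α j : ℝ) ≠ 0 →
      Real.exp (-(Cw (n + 1) * (∏ j, V j) * (W + Real.log (2 * V (Fin.last n))) *
          Real.log (2 * (if n = 0 then 1 else V ⟨n - 1, by omega⟩)) / Real.log 2 ^ (n + 2))) <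
        |∑ j, (b j : ℝ) * Real.log (α j : ℝ)|) :
    BakerShapeBound (1 / 3) 3 := by
  obtain ⟨Ca, hCa1, hCa⟩ := exists_prod_mul_log_sq_div_le (show (0 : ℝ) ≤ 4 * K ^ 2 by positivity)
  obtain ⟨C₁, hC₁1, hC₁⟩ := exists_prod_two_mul_max_log_le (zero_le_one.trans hK)
  set κ₁ : ℝ := 64 * K ^ 3 * (2 * (2 * Ca)) * (Real.log (16 * K ^ 3 * (2 * (2 * Ca))) + 3) with hκ₁
  set M₀ : ℝ := 1800 * max 1 (max (max (Cw 2) (Cw 3)) (Cw 4)) *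
    (Real.log 6 + Real.log K + 2 * Real.log C₁ + 8) * K * C₁ ^ 2 with hM₀
  set κ₂ : ℝ := 32 * 240 ^ 5 * (4 * M₀) * (Real.log (32 * (4 * M₀)) + 7) ^ 2 with hκ₂
  have hK3 : 1 ≤ K ^ 3 := one_le_pow₀ hK
  have hCa4 : 1 ≤ 2 * (2 * Ca) := by linarith
  have hc₀0 : 0 ≤ Real.log (16 * K ^ 3 * (2 * (2 * Ca))) := Real.log_nonneg (by nlinarith)
  have hκ₁192 : (192 : ℝ) ≤ κ₁ := by
    have h3 : (3 : ℝ) ≤ Real.log (16 * K ^ 3 * (2 * (2 * Ca))) + 3 := by linarith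
    calc (192 : ℝ) = 64 * 1 * 1 * 3 := by norm_num
      _ ≤ 64 * K ^ 3 * (2 * (2 * Ca)) * (Real.log (16 * K ^ 3 * (2 * (2 * Ca))) + 3) :=
          mul_le_mul (mul_le_mul (mul_le_mul_of_nonneg_left hK3 (by norm_num)) hCa4 zero_le_one
            (by positivity)) h3 (by norm_num) (by positivity)
  have hD1 : 1 ≤ Real.log 6 + Real.log K + 2 * Real.log C₁ + 8 := by
    have h6 : 0 ≤ Real.log 6 := Real.log_nonneg (by norm_num)
    have hK' : 0 ≤ Real.log K := Real.log_nonneg hK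
    have hC₁' : 0 ≤ Real.log C₁ := Real.log_nonneg hC₁1
    linarith
  have hM₀1 : 1 ≤ M₀ := by
    have h1 : (1 : ℝ) ≤ max 1 (max (max (Cw 2) (Cw 3)) (Cw 4)) := le_max_left _ _
    have h2 : (1 : ℝ) ≤ C₁ ^ 2 := one_le_pow₀ hC₁1
    calc (1 : ℝ) ≤ 1800 * 1 * 1 * 1 * 1 := by norm_num
      _ ≤ 1800 * max 1 (max (max (Cw 2) (Cw 3)) (Cw 4)) *
          (Real.log 6 + Real.log K + 2 * Real.log C₁ + 8) * K * C₁ ^ 2 :=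
          mul_le_mul (mul_le_mul (mul_le_mul (mul_le_mul_of_nonneg_left h1 (by norm_num)) hD1
            zero_le_one (by positivity)) hK zero_le_one (by positivity)) h2 zero_le_one
            (by positivity)
  have hκ₂0 : 0 ≤ κ₂ := by
    have : 0 ≤ M₀ := zero_le_one.trans hM₀1
    positivity
  -- w.l.o.g. `a ≤ b`
  suffices key : ∀ a b c : ℕ, IsABCTriple a b c → a ≤ b →
      Real.log c ≤ max κ₁ κ₂ * (rad a b c : ℝ) ^ (1 / 3 : ℝ) * Real.log (rad a b c : ℕ) ^ 3 by
    refine ⟨max κ₁ κ₂, fun a b c h => ?_⟩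
    rcases le_total a b with hab | hba
    · exact key a b c h hab
    · have := key b a c h.swap hba
      rwa [rad_swap] at this
  intro a b c h hab
  obtain ⟨ha, hb, habc, hcop⟩ := id h
  have hR2 : (2 : ℝ) ≤ (rad a b c : ℝ) := by
    have : 2 ≤ rad a b c := by
      rw [rad_def, Nat.two_le_radical_iff]
      calc 2 ≤ c := by omega
        _ ≤ a * b * c := Nat.le_mul_of_pos_left c (Nat.mul_pos ha hb)
    exact_mod_cast this
  set R : ℝ := ((rad a b c : ℕ) : ℝ) with hR
  have hlogR : 0 ≤ Real.log R := Real.log_nonneg (by linarith)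
  have hRL : 0 ≤ R ^ (1 / 3 : ℝ) * Real.log R ^ 3 := by positivity
  by_cases h1 : 1 < a * b
  · rcases le_or_gt (c : ℝ) ((a : ℝ) ^ 2) with hca | hac2
    · -- first regime: linear `p`-adic routes only
      have h' := log_le_of_le_sq_placeBoundsLin hK hpad hpadc hCa1 hCa h hab hca
      calc Real.log c ≤ κ₁ * R ^ (1 / 3 : ℝ) * Real.log R ^ 3 := h'
        _ = κ₁ * (R ^ (1 / 3 : ℝ) * Real.log R ^ 3) := by ring
        _ ≤ max κ₁ κ₂ * (R ^ (1 / 3 : ℝ) * Real.log R ^ 3) :=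
            mul_le_mul_of_nonneg_right (le_max_left _ _) hRL
        _ = max κ₁ κ₂ * R ^ (1 / 3 : ℝ) * Real.log R ^ 3 := by ring
    · -- second regime, Kummer version, linear place bounds
      have h' := log_le_of_sq_lt_kummer₂_placeBoundsLin hK hpad hpadc Cw hCw hW₂ hC₁1 hC₁ h hab h1
        hac2
      have h'' : Real.log c ≤ M₀ * R ^ (7 / 24 : ℝ) * max 1 (Real.log R) ^ 6 *
          (max 1 (Real.log R) + Real.log (max (Real.exp 1) (2 * Real.log c))) ^ 2 := by
        rw [hM₀]; exact h'
      have h3 := regimeII_endgame6_lin hM₀1 hR2 h''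
      calc Real.log c ≤ κ₂ * R ^ (1 / 3 : ℝ) * Real.log R ^ 3 := by rw [hκ₂]; exact h3
        _ = κ₂ * (R ^ (1 / 3 : ℝ) * Real.log R ^ 3) := by ring
        _ ≤ max κ₁ κ₂ * (R ^ (1 / 3 : ℝ) * Real.log R ^ 3) :=
            mul_le_mul_of_nonneg_right (le_max_right _ _) hRL
        _ = max κ₁ κ₂ * R ^ (1 / 3 : ℝ) * Real.log R ^ 3 := by ring
  · -- the triple `1 + 1 = 2`
    have hab1 : a * b = 1 := by
      have : 1 ≤ a * b := Nat.mul_pos ha hb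
      omega
    have ha1 : a = 1 := Nat.eq_one_of_mul_eq_one_right hab1
    have hb1 : b = 1 := Nat.eq_one_of_mul_eq_one_left hab1
    have hc2 : c = 2 := by omega
    have hκ : (192 : ℝ) ≤ max κ₁ κ₂ := hκ₁192.trans (le_max_left _ _)
    have hR13 : 1 ≤ R ^ (1 / 3 : ℝ) := Real.one_le_rpow (by linarith) (by norm_num)
    have hL : (0.69 : ℝ) ≤ Real.log R :=
      le_trans (by have := Real.log_two_gt_d9; linarith) (Real.log_le_log two_pos hR2)
    have hL3 : (0.69 : ℝ) ^ 3 ≤ Real.log R ^ 3 := pow_le_pow_left₀ (by norm_num) hL 3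
    have hlog2 : Real.log 2 ≤ 0.7 := by have := Real.log_two_lt_d9; linarith
    calc Real.log c = Real.log 2 := by rw [hc2]; norm_num
      _ ≤ 0.7 := hlog2
      _ ≤ 192 * 1 * (0.69 : ℝ) ^ 3 := by norm_num
      _ ≤ max κ₁ κ₂ * R ^ (1 / 3 : ℝ) * Real.log R ^ 3 :=
          mul_le_mul (mul_le_mul hκ hR13 zero_le_one (by linarith)) hL3 (by norm_num)
            (by positivity)

/-- **`BakerMethodBounds` from the two LINEAR `p`-adic place bounds (constant `K ≥ 1`) and the `E = 2` form of a
Kummer-conditional archimedean bound with arbitrary constants** — the LINEAR DOOR: Stewart–Yu's exponent `1/3` with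
`(log rad)^3` survives the linear place factor `p · (log p + Y)` (`BakerMethodBounds` is `BakerShapeBound (1/3) 3` by
definition). [cite: StewartYu2001, Theorem 1] [cite: Waldschmidt1980, Prop 3.8 (p. 274)] -/
theorem BakerMethodBounds_of_placeBoundsLin_kummerArchBound₂ (hK : 1 ≤ K)
    (hpad : ∀ {a b c : ℕ}, IsABCTriple a b c → ∀ {p : ℕ}, p.Prime → p ∣ a →
      (a.factorization p : ℝ) * Real.log p < theta K b c 0 *
        ((p : ℝ) * (Real.log p + Real.log (max (Real.exp 1) (2 * Real.log c)))))
    (hpadc : ∀ {a b c : ℕ}, IsABCTriple a b c → 1 < a * b → ∀ {p : ℕ}, p.Prime → p ∣ c →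
      (c.factorization p : ℝ) * Real.log p < theta K a b 0 *
        ((p : ℝ) * (Real.log p + Real.log (max (Real.exp 1) (2 * Real.log c)))))
    (Cw : ℕ → ℝ) (hCw : ∀ n, 0 ≤ Cw n)
    (hW₂ : ∀ (n : ℕ) (α : Fin (n + 1) → ℚ) (b : Fin (n + 1) → ℤ) (V : Fin (n + 1) → ℝ) (W : ℝ),
      (∀ j, 0 < α j ∧ α j ≠ 1) →
      Module.finrank ℚ ↥(IntermediateField.adjoin ℚ
          (Set.range fun j => Real.sqrt (α j : ℝ))) = 2 ^ (n + 1) →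
      Monotone V → 1 ≤ V 0 →
      (∀ j, max (logHeight₁ (α j)) |Real.log (α j : ℝ)| ≤ V j) →
      0 < W → (∀ j, logHeight₁ (b j : ℚ) ≤ W) →
      ∑ j, (b j : ℝ) * Real.log (α j : ℝ) ≠ 0 →
      Real.exp (-(Cw (n + 1) * (∏ j, V j) * (W + Real.log (2 * V (Fin.last n))) *
          Real.log (2 * (if n = 0 then 1 else V ⟨n - 1, by omega⟩)) / Real.log 2 ^ (n + 2))) <
        |∑ j, (b j : ℝ) * Real.log (α j : ℝ)|) :
    BakerMethodBounds :=
  bakerShapeBound_third_three_of_placeBoundsLin_kummerArchBound₂ hK hpad hpadc Cw hCw hW₂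

/-- **From a `p / log p` place bound to a linear one** (compatibility of the two doors): at threshold `N = 0`, a
bound `ν log p < Θ^{(K)}_{uv} · (p / log p) X` (`X ≥ 0`) gives `ν log p < Θ^{(2K)}_{uv} · p X`, because
`1 / log p ≤ 1 / log 2 < 2` and `Θ^{(2K)}_{uv} = 2^{ω(uv)+1} Θ^{(K)}_{uv} ≥ 2 Θ^{(K)}_{uv}` (`theta_zero_eq`).  So the
place bounds of file VII-B (constant `K`) imply the linear place bounds (constant `2K`), and
`BakerMethodBounds_of_placeBounds_kummerArchBound₂` is a special case of
`BakerMethodBounds_of_placeBoundsLin_kummerArchBound₂` (the `example` below).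
[cite: StewartYu2001, Theorem 1 (proof, §3), as reconstructed] -/
theorem placeBoundLin_of_placeBound (hK : 1 ≤ K) {u v : ℕ} (hu : u ≠ 0) (hv : v ≠ 0)
    (huv : u.Coprime v) {p : ℕ} (hp : p.Prime) {X ν : ℝ} (hX : 0 ≤ X)
    (h : ν * Real.log p < theta K u v 0 * ((p / Real.log p) * X)) :
    ν * Real.log p < theta (2 * K) u v 0 * ((p : ℝ) * X) := by
  have hlog2 : (1 / 2 : ℝ) < Real.log 2 := by have := Real.log_two_gt_d9; linarith
  have hlogp : Real.log 2 ≤ Real.log p := Real.log_le_log two_pos (by exact_mod_cast hp.two_le)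
  have hlogp0 : 0 < Real.log p := by linarith
  have hp0 : (0 : ℝ) ≤ p := Nat.cast_nonneg p
  -- `p / log p ≤ 2 p`
  have hdiv : (p : ℝ) / Real.log p ≤ 2 * p := by
    rw [div_le_iff₀ hlogp0]; nlinarith
  -- `2 · Θ^{(K)} ≤ Θ^{(2K)}` at threshold `0`
  have hΘ : 2 * theta K u v 0 ≤ theta (2 * K) u v 0 := by
    have hprod : 0 ≤ ∏ q ∈ (u * v).primeFactors, Real.log (q : ℝ) :=
      (prod_log_primeFactors_pos _).le
    have hKpow : 0 ≤ K ^ ((u * v).primeFactors.card + 1) := pow_nonneg (zero_le_one.trans hK) _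
    have h2 : (2 : ℝ) ≤ 2 ^ ((u * v).primeFactors.card + 1) := by
      calc (2 : ℝ) = 2 ^ 1 := by norm_num
        _ ≤ 2 ^ ((u * v).primeFactors.card + 1) := pow_le_pow_right₀ (by norm_num) (by omega)
    rw [theta_zero_eq K hu hv huv, theta_zero_eq (2 * K) hu hv huv, mul_pow]
    calc 2 * (K ^ ((u * v).primeFactors.card + 1) * ∏ q ∈ (u * v).primeFactors, Real.log (q : ℝ))
        ≤ 2 ^ ((u * v).primeFactors.card + 1) *
            (K ^ ((u * v).primeFactors.card + 1) * ∏ q ∈ (u * v).primeFactors, Real.log (q : ℝ)) :=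
          mul_le_mul_of_nonneg_right h2 (mul_nonneg hKpow hprod)
      _ = 2 ^ ((u * v).primeFactors.card + 1) * K ^ ((u * v).primeFactors.card + 1) *
            ∏ q ∈ (u * v).primeFactors, Real.log (q : ℝ) := by ring
  have hΘ0 : 0 ≤ theta K u v 0 := theta_nonneg (zero_le_one.trans hK) u v 0
  calc ν * Real.log p < theta K u v 0 * ((p / Real.log p) * X) := h
    _ ≤ theta K u v 0 * (2 * p * X) :=
        mul_le_mul_of_nonneg_left (mul_le_mul_of_nonneg_right hdiv hX) hΘ0
    _ = 2 * theta K u v 0 * ((p : ℝ) * X) := by ring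
    _ ≤ theta (2 * K) u v 0 * ((p : ℝ) * X) := mul_le_mul_of_nonneg_right hΘ (by positivity)

/- Compatibility check (kernel-verified, not a new result): the `p / log p` door of file VII-B,
`BakerMethodBounds_of_placeBounds_kummerArchBound₂`, as the special case `K ↦ 2K` of the linear door. -/
example (hK : 1 ≤ K)
    (hpad : ∀ {a b c : ℕ}, IsABCTriple a b c → ∀ {p : ℕ}, p.Prime → p ∣ a →
      (a.factorization p : ℝ) * Real.log p < theta K b c 0 *
        ((p / Real.log p) * (Real.log p + Real.log (max (Real.exp 1) (2 * Real.log c)))))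
    (hpadc : ∀ {a b c : ℕ}, IsABCTriple a b c → 1 < a * b → ∀ {p : ℕ}, p.Prime → p ∣ c →
      (c.factorization p : ℝ) * Real.log p < theta K a b 0 *
        ((p / Real.log p) * (Real.log p + Real.log (max (Real.exp 1) (2 * Real.log c)))))
    (Cw : ℕ → ℝ) (hCw : ∀ n, 0 ≤ Cw n)
    (hW₂ : ∀ (n : ℕ) (α : Fin (n + 1) → ℚ) (b : Fin (n + 1) → ℤ) (V : Fin (n + 1) → ℝ) (W : ℝ),
      (∀ j, 0 < α j ∧ α j ≠ 1) →
      Module.finrank ℚ ↥(IntermediateField.adjoin ℚ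
          (Set.range fun j => Real.sqrt (α j : ℝ))) = 2 ^ (n + 1) →
      Monotone V → 1 ≤ V 0 →
      (∀ j, max (logHeight₁ (α j)) |Real.log (α j : ℝ)| ≤ V j) →
      0 < W → (∀ j, logHeight₁ (b j : ℚ) ≤ W) →
      ∑ j, (b j : ℝ) * Real.log (α j : ℝ) ≠ 0 →
      Real.exp (-(Cw (n + 1) * (∏ j, V j) * (W + Real.log (2 * V (Fin.last n))) *
          Real.log (2 * (if n = 0 then 1 else V ⟨n - 1, by omega⟩)) / Real.log 2 ^ (n + 2))) <
        |∑ j, (b j : ℝ) * Real.log (α j : ℝ)|) :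
    BakerMethodBounds := by
  have h2K : (1 : ℝ) ≤ 2 * K := by linarith
  have hX : ∀ (p c : ℕ), p.Prime → 0 ≤ Real.log p + Real.log (max (Real.exp 1) (2 * Real.log c)) :=
    fun p c hp => by
      have h1 := one_le_log_max_exp (2 * Real.log c)
      have h2 : 0 ≤ Real.log p := Real.log_nonneg (by exact_mod_cast hp.one_lt.le)
      linarith
  refine BakerMethodBounds_of_placeBoundsLin_kummerArchBound₂ h2K ?_ ?_ Cw hCw hW₂
  · intro a b c h p hp hpa
    obtain ⟨ha, hb, habc, hcop⟩ := id h
    exact placeBoundLin_of_placeBound hK hb.ne' (by omega) (coprime_right_of_isABCTriple h) hp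
      (hX p c hp) (hpad h hp hpa)
  · intro a b c h h1 p hp hpc
    obtain ⟨ha, hb, habc, hcop⟩ := id h
    exact placeBoundLin_of_placeBound hK ha.ne' hb.ne' hcop hp (hX p c hp) (hpadc h h1 hp hpc)

end AssemblyLinearPlaceBounds

end Literature.Barriers.ABC

end
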